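import Mathlib
import Summits.QuantumFields.YangMills.Theorems.SelfNormalisedSkewness.Negative.SelfNormalisedSkewnessFalseOfMaxwellDominatedWindowScheme
import Literature.MathematicalPhysics.QuantumFieldTheory.CurvatureGaussianField
import Literature.MathematicalPhysics.QuantumLattice.LatticeScalarField
import Literature.Probability.LatticeModels.LatticeGreenGradient
import Summits.QuantumFields.YangMills.Theorems.WeakCouplingRatesCurvatureKernel

/-!
# BC5 rung (T3 witness) for `StaticSourceWitness.X₁ = StaticSourceResponse`
# — the Gaussian (free abelian) static-source response identity and its ratio floor

Tribunal-w seat `ym-mirror-bc5w-1` (2026-08-28) for item `stmt-QuantumFields-25284`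
(route `route-QuantumFields-StaticSourceWitness`), answering the judge's `T3-absent`
(verdict-StaticSourceWitness-ym-trib-j-1: "a free U(1)₄ / lattice-Maxwell instance of X₁ in RATIO
form at fixed coupling").

**The lever of X₁** is the normalisation `c₁·E[w] ≤ |Cov(w∘θ, Ṽ_v)|`: a far-mirror Wilson loop `w`
whose expectation is perimeter-law SMALL still certifies an `O(1)` response RATIO.  In any free
(Gaussian, abelian) gauge theory this is an exact identity.  Write the mirror loop as `w = cos Φ`
(`Φ = ∮_{θC} A`, the abelian holonomy angle — lattice Stokes: the signed sum of the plaquette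
curvatures `Y_p` over a spanning surface) and the probe as `Ṽ_v = ∑_q v_q Y_q²` (plaquette energies).
For a centred jointly Gaussian pair `(Φ, Y)`:

  `Cov(cos Φ, Y²) = −E[cos Φ]·Cov(Φ, Y)²`,  `E[cos Φ] = e^{−Var Φ/2} > 0`      (★)

(`gaussian_staticSource_identity`), so `|Cov(w, Ṽ_v)| / E[w] = ∑_q v_q Cov(Φ, Y_q)²` EXACTLY — the
classical field energy of the static source `θC` inside the probe — however small `E[w]` is.
`gaussian_staticSource_floor` is X₁'s witness clause in this model: `Cov(Φ,Y)² ≥ c₁` (dipole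
coupling floor) gives `0 < E[w] ∧ c₁·E[w] ≤ |Cov(w, Y²)|` with the SAME `c₁` for every `Var Φ = σ²`
(arbitrarily large: `E[w] = e^{−σ²/2}` arbitrarily small — the far-mirror / perimeter regime), i.e.
the projective normalisation is the right one and loses nothing in the free theory.

Everything in this file is proved (sorry-free).  Parts A.1–A.2: (★) in the canonical Cholesky
coordinates of a centred 2D Gaussian pair, `Φ = s·ξ₁`, `Y = p·ξ₁ + q·ξ₂`, `ξ₁, ξ₂` i.i.d. `N(0,1)`
(`Var Φ = s²`, `Cov(Φ,Y) = sp`, `Var Y = p² + q²`); the Gaussian trigonometric moments come from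
Mathlib's `charFun_gaussianReal` and `iteratedDeriv_charFun`.  Part A.4: (★) for ANY centred
Gaussian pair `(U, V)` on any probability space (`gaussianPair_staticSource_identity/_floor`), by
identifying the law of `(U, V)` with `(γ ⊗ γ) ∘ T_{s,p,q}⁻¹` through Mathlib's
`IsGaussian.ext_covarianceBilinDual` (a Gaussian measure is determined by mean and covariance form;
the covariance Cauchy–Schwarz `Cov² ≤ Var·Var` is proved on the way, `chol_exists`).
Part B: the LATTICE MAXWELL FIELD `μ = curvatureGaussianField 4 1` of the tree (Garban–Sepúlveda
`dGd*` covariance): `(Φ_rect, Y_q)` is a centred Gaussian pair (`hasGaussianLaw_holonomy_plaquette`,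
from `isGaussianProcess_eval_curvatureGaussianField`), `Cov(Φ_rect, Y_q) = dipoleField rect q`
(`cov_holonomy_plaquette`), hence for EVERY rectangle, probe, spacing `a` and volume `L`

  `Cov_μ(cos Φ_rect, Ṽ_v) = −E_μ[cos Φ_rect] · dipoleEnergy a v rect L`  (`latticeMaxwell_probe_response`)

and X₁'s witness clause `0 < E[w] ∧ c₁·E[w] ≤ |Cov(w, Ṽ_v)|` follows from the purely DETERMINISTIC
floor `c₁ ≤ dipoleEnergy` (`latticeMaxwell_X1_of_floor`); the X₁-shaped lattice statement (probe per
window, `c₁` uniform in `a ≤ a₀` and `L`, mirror rectangle in `{y₀ < 0}`) is reduced to the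
lattice-potential-theory statement `DipoleEnergyFloor` (`latticeMaxwell_staticSourceResponse_of_floor`).
Part C (v3, 2026-08-28) PROVES `DipoleEnergyFloor` (`dipoleEnergyFloor`; formerly the plan-only stub
`Lines/rung_plan.lean: stub_rung_dipoleEnergyFloor`) from the tree's curvature-kernel closed form
(`WeakCouplingRates.curvatureTwoPoint_eq_curl_greenTensor`, `curl_greenTensor_parallel`) and the
Lawler (1.37) second-difference asymptotics of the `ℤ⁴` Green function
(`Literature…latticeGreen_second_diff_continuum`): a HYPERSCALING configuration — source rectangle
`N × N` with `N = ⌊ℓ/(64a)⌋` plaquettes in the `(1,2)` plane at `−X e₀`, `X = ⌊ℓ/(2a)⌋`, probe a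
fixed bump `≡ 1` on the `(2N+1)⁴`-site box around `+X e₀` — in which the parallel-plaquette kernel
is `≥ 1/(4π²|z|⁴)` on the cone `4(z₁²+z₂²) ≤ |z|²`, every kernel value is `≥ c/N⁴`, the source
field is `≥ c/N²` at each of the `(2N+1)⁴` probe sites, and the `a`-powers cancel exactly:
`dipoleEnergy ≥ c₁ = 1/(16 π⁴ 16650⁴)` for all `a ≤ a₀ = ℓ/(128 R₀)` and all `L ≥ ℓ/a`.  Hence the
X₁-shaped lattice-Maxwell statement holds UNCONDITIONALLY (`latticeMaxwell_staticSourceResponse`).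

**Separation from S** (same free abelian universality class): S = `BalabanLadder.NT` carries clause
(ii) (three-point floor), which FAILS in the free Maxwell model (`freeAbelian_NT_clauseII_false`, from
the tree's `maxwellRing3_eq_zero`), while X₁'s analogue (★)/floor HOLDS: a model deciding C's analogue
TRUE and S's analogue FALSE.

NOTHING HERE PROVES the Yang–Mills mass gap, `NT`, or any item of the route.
-/

open MeasureTheory ProbabilityTheory Complex
open scoped Real NNReal ENNReal

noncomputable section

namespace Summit.QuantumFields.YangMills.Cruxes.StaticSourceResponse.Rung

/-! ## Part A.1 — standard Gaussian trigonometric moments via the characteristic function -/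

/-- The standard normal law. [folklore] -/
abbrev γ : Measure ℝ := gaussianReal 0 1

/-- `t ↦ e^{−t²/2}` as a complex-valued function of a real variable. [folklore] -/
def F (t : ℝ) : ℂ := Complex.exp ((-(t ^ 2 / 2) : ℝ) : ℂ)

theorem charFun_γ (t : ℝ) : charFun γ t = F t := by
  rw [charFun_gaussianReal, F]
  congr 1
  push_cast
  ring

theorem charFun_eq_F : charFun γ = F := funext charFun_γ

theorem hasDerivAt_negSqHalf (t : ℝ) : HasDerivAt (fun x : ℝ => -(x ^ 2 / 2)) (-t) t := by
  have h : HasDerivAt (fun x : ℝ => x ^ 2 / 2) t t := by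
    refine ((hasDerivAt_pow 2 t).div_const 2).congr_deriv ?_
    rw [show (2 : ℕ) - 1 = 1 from rfl, pow_one]
    push_cast
    ring
  exact h.neg

theorem hasDerivAt_F (t : ℝ) : HasDerivAt F (F t * ((-t : ℝ) : ℂ)) t :=
  (hasDerivAt_negSqHalf t).ofReal_comp.cexp

theorem deriv_F : deriv F = fun t => F t * ((-t : ℝ) : ℂ) :=
  funext fun t => (hasDerivAt_F t).deriv

theorem iteratedDeriv_two_F (t : ℝ) : iteratedDeriv 2 F t = F t * ((t ^ 2 - 1 : ℝ) : ℂ) := by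
  rw [iteratedDeriv_succ, iteratedDeriv_one, deriv_F]
  have h2 : HasDerivAt (fun t : ℝ => F t * ((-t : ℝ) : ℂ))
      (F t * ((-t : ℝ) : ℂ) * ((-t : ℝ) : ℂ) + F t * ((-1 : ℝ) : ℂ)) t :=
    (hasDerivAt_F t).mul (hasDerivAt_neg (x := t)).ofReal_comp
  rw [h2.deriv]
  push_cast
  ring

theorem memLp_two_γ : MemLp id 2 γ := memLp_id_gaussianReal' 2 (by simp)

theorem integrable_sq_γ : Integrable (fun x : ℝ => x ^ 2) γ := by
  have h := (memLp_two_iff_integrable_sq measurable_id.aestronglyMeasurable).1 memLp_two_γ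
  simpa using h

theorem integrable_id_γ : Integrable (fun x : ℝ => x) γ :=
  memLp_one_iff_integrable.1 (memLp_id_gaussianReal' 1 (by simp))

theorem integrable_abs_γ : Integrable (fun x : ℝ => |x|) γ := by
  simpa [Real.norm_eq_abs] using integrable_id_γ.norm

/-- `∫ e^{isx} dγ = e^{−s²/2}`. [folklore] -/
theorem integral_cexp (s : ℝ) : ∫ x, Complex.exp ((s : ℂ) * x * I) ∂γ = F s := by
  rw [← charFun_apply_real, charFun_γ]

/-- `∫ x e^{isx} dγ = i s e^{−s²/2}`. [folklore] -/
theorem integral_x_cexp (s : ℝ) :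
    ∫ x, (x : ℂ) * Complex.exp ((s : ℂ) * x * I) ∂γ = I * (s : ℂ) * F s := by
  have hint : MemLp id ((1 : ℕ) : ℝ≥0∞) γ := by
    rw [Nat.cast_one]; exact memLp_id_gaussianReal' 1 (by simp)
  have h := iteratedDeriv_charFun (μ := γ) (n := 1) (t := s) hint
  rw [iteratedDeriv_one, charFun_eq_F, deriv_F] at h
  simp only [pow_one] at h
  -- h : F s * ↑(-s) = I * ∫ x, ↑x * cexp (↑s * ↑x * I) ∂γ
  have h' : ∫ x, (x : ℂ) * Complex.exp ((s : ℂ) * x * I) ∂γ = -I * (F s * ((-s : ℝ) : ℂ)) := by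
    rw [h, ← mul_assoc, show -I * I = 1 by rw [neg_mul, I_mul_I, neg_neg], one_mul]
  rw [h']
  push_cast
  ring

/-- `∫ x² e^{isx} dγ = (1 − s²) e^{−s²/2}`. [folklore] -/
theorem integral_x2_cexp (s : ℝ) :
    ∫ x, (x : ℂ) ^ 2 * Complex.exp ((s : ℂ) * x * I) ∂γ = F s * ((1 - s ^ 2 : ℝ) : ℂ) := by
  have h := iteratedDeriv_charFun (μ := γ) (n := 2) (t := s) memLp_two_γ
  rw [charFun_eq_F, iteratedDeriv_two_F] at h
  -- h : F s * ↑(s^2-1) = I^2 * ∫ x, ↑x^2 * cexp (↑s * ↑x * I) ∂γ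
  have h' : ∫ x, (x : ℂ) ^ 2 * Complex.exp ((s : ℂ) * x * I) ∂γ = -(F s * ((s ^ 2 - 1 : ℝ) : ℂ)) := by
    rw [h, I_sq]; ring
  rw [h']
  push_cast
  ring

theorem re_F_mul (s a : ℝ) : (F s * (a : ℂ)).re = Real.exp (-(s ^ 2 / 2)) * a := by
  rw [F, ← Complex.ofReal_exp, ← Complex.ofReal_mul, Complex.ofReal_re]

/-- `E[cos(sξ)] = e^{−s²/2}`. [folklore] -/
theorem integral_cos (s : ℝ) : ∫ x, Real.cos (s * x) ∂γ = Real.exp (-(s ^ 2 / 2)) := by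
  have hf : Integrable (fun x : ℝ => Complex.exp ((s : ℂ) * x * I)) γ := by
    refine (integrable_const (1 : ℝ)).mono' (by fun_prop) (Filter.Eventually.of_forall fun x => ?_)
    rw [← Complex.ofReal_mul, Complex.norm_exp_ofReal_mul_I]
  have h := congrArg Complex.re (integral_cexp s)
  have hre := integral_re hf
  simp only [RCLike.re_to_complex] at hre
  rw [← hre] at h
  have e : ∀ x : ℝ, (Complex.exp ((s : ℂ) * x * I)).re = Real.cos (s * x) := fun x => by
    rw [← Complex.ofReal_mul]; exact Complex.exp_ofReal_mul_I_re _
  simp_rw [e] at h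
  rw [h]
  have := re_F_mul s 1
  simpa using this

/-- `E[ξ cos(sξ)] = 0`. [folklore] -/
theorem integral_x_cos (s : ℝ) : ∫ x, x * Real.cos (s * x) ∂γ = 0 := by
  have hf : Integrable (fun x : ℝ => (x : ℂ) * Complex.exp ((s : ℂ) * x * I)) γ := by
    refine integrable_abs_γ.mono' (by fun_prop) (Filter.Eventually.of_forall fun x => ?_)
    rw [norm_mul, ← Complex.ofReal_mul, Complex.norm_exp_ofReal_mul_I, mul_one, Complex.norm_real,
      Real.norm_eq_abs]
  have h := congrArg Complex.re (integral_x_cexp s)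
  have hre := integral_re hf
  simp only [RCLike.re_to_complex] at hre
  rw [← hre] at h
  have e : ∀ x : ℝ, ((x : ℂ) * Complex.exp ((s : ℂ) * x * I)).re = x * Real.cos (s * x) :=
    fun x => by
      rw [← Complex.ofReal_mul]
      show ((x : ℂ) * Complex.exp (((s * x : ℝ) : ℂ) * I)).re = _
      rw [Complex.re_ofReal_mul, Complex.exp_ofReal_mul_I_re]
  simp_rw [e] at h
  rw [h, F, ← Complex.ofReal_exp, mul_assoc, ← Complex.ofReal_mul, Complex.I_mul_re,
    Complex.ofReal_im, neg_zero]

/-- `E[ξ² cos(sξ)] = (1 − s²) e^{−s²/2}`. [folklore] -/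
theorem integral_x2_cos (s : ℝ) :
    ∫ x, x ^ 2 * Real.cos (s * x) ∂γ = Real.exp (-(s ^ 2 / 2)) * (1 - s ^ 2) := by
  have hf : Integrable (fun x : ℝ => (x : ℂ) ^ 2 * Complex.exp ((s : ℂ) * x * I)) γ := by
    refine integrable_sq_γ.mono' (by fun_prop) (Filter.Eventually.of_forall fun x => ?_)
    rw [norm_mul, ← Complex.ofReal_mul, Complex.norm_exp_ofReal_mul_I, mul_one, norm_pow,
      Complex.norm_real, Real.norm_eq_abs, sq_abs]
  have h := congrArg Complex.re (integral_x2_cexp s)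
  have hre := integral_re hf
  simp only [RCLike.re_to_complex] at hre
  rw [← hre] at h
  have e : ∀ x : ℝ, ((x : ℂ) ^ 2 * Complex.exp ((s : ℂ) * x * I)).re = x ^ 2 * Real.cos (s * x) :=
    fun x => by
      rw [← Complex.ofReal_mul, ← Complex.ofReal_pow]
      show (((x ^ 2 : ℝ) : ℂ) * Complex.exp (((s * x : ℝ) : ℂ) * I)).re = _
      rw [Complex.re_ofReal_mul, Complex.exp_ofReal_mul_I_re]
  simp_rw [e] at h
  rw [h, re_F_mul]

/-- Second moment `E[ξ²] = 1` (the `s = 0` case). [folklore] -/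
theorem integral_x2 : ∫ x, x ^ 2 ∂γ = 1 := by
  have := integral_x2_cos 0
  simpa using this

/-- First moment `E[ξ] = 0`. [folklore] -/
theorem integral_x1 : ∫ x, x ∂γ = 0 := integral_id_gaussianReal

/-- Integrability of the real trigonometric-moment integrands. [folklore] -/
theorem integrable_cos (s : ℝ) : Integrable (fun x : ℝ => Real.cos (s * x)) γ :=
  (integrable_const (1 : ℝ)).mono' (by fun_prop)
    (Filter.Eventually.of_forall fun x => by
      simpa [Real.norm_eq_abs] using Real.abs_cos_le_one (s * x))

theorem integrable_x_cos (s : ℝ) : Integrable (fun x : ℝ => x * Real.cos (s * x)) γ :=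
  integrable_abs_γ.mono' (by fun_prop)
    (Filter.Eventually.of_forall fun x => by
      rw [norm_mul, Real.norm_eq_abs, Real.norm_eq_abs]
      exact mul_le_of_le_one_right (abs_nonneg x) (Real.abs_cos_le_one _))

theorem integrable_x2_cos (s : ℝ) : Integrable (fun x : ℝ => x ^ 2 * Real.cos (s * x)) γ :=
  integrable_sq_γ.mono' (by fun_prop)
    (Filter.Eventually.of_forall fun x => by
      rw [norm_mul, Real.norm_eq_abs, Real.norm_eq_abs, abs_of_nonneg (sq_nonneg x)]
      exact mul_le_of_le_one_right (sq_nonneg x) (Real.abs_cos_le_one _))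

/-! ## Part A.2 — the centred 2D Gaussian pair in Cholesky coordinates
`Φ = s ξ₁` (static source: mirror-loop holonomy angle), `Y = p ξ₁ + q ξ₂` (one plaquette curvature);
`w = cos Φ` (abelian Wilson loop), `Y²` (plaquette energy). -/

/-- The law of `(ξ₁, ξ₂)`: two independent standard normals. [folklore] -/
abbrev μ2 : Measure (ℝ × ℝ) := γ.prod γ

/-- `E[cos Φ · Y²] = e^{−s²/2} (p²(1−s²) + q²)`. [folklore] -/
theorem integral_cos_mul_Y2 (s p q : ℝ) :
    ∫ ξ, Real.cos (s * ξ.1) * (p * ξ.1 + q * ξ.2) ^ 2 ∂μ2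
      = Real.exp (-(s ^ 2 / 2)) * (p ^ 2 * (1 - s ^ 2) + q ^ 2) := by
  have e : ∀ ξ : ℝ × ℝ, Real.cos (s * ξ.1) * (p * ξ.1 + q * ξ.2) ^ 2
      = p ^ 2 * ((ξ.1 ^ 2 * Real.cos (s * ξ.1)) * 1) + 2 * p * q * ((ξ.1 * Real.cos (s * ξ.1)) * ξ.2)
        + q ^ 2 * (Real.cos (s * ξ.1) * ξ.2 ^ 2) := fun ξ => by ring
  simp_rw [e]
  have h1 : Integrable (fun ξ : ℝ × ℝ => p ^ 2 * ((ξ.1 ^ 2 * Real.cos (s * ξ.1)) * 1)) μ2 :=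
    (((integrable_x2_cos s).mul_prod (integrable_const (1 : ℝ))).const_mul _)
  have h2 : Integrable (fun ξ : ℝ × ℝ => 2 * p * q * ((ξ.1 * Real.cos (s * ξ.1)) * ξ.2)) μ2 :=
    (((integrable_x_cos s).mul_prod integrable_id_γ).const_mul _)
  have h3 : Integrable (fun ξ : ℝ × ℝ => q ^ 2 * (Real.cos (s * ξ.1) * ξ.2 ^ 2)) μ2 :=
    (((integrable_cos s).mul_prod integrable_sq_γ).const_mul _)
  have h12 : Integrable (fun ξ : ℝ × ℝ => p ^ 2 * ((ξ.1 ^ 2 * Real.cos (s * ξ.1)) * 1)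
      + 2 * p * q * ((ξ.1 * Real.cos (s * ξ.1)) * ξ.2)) μ2 := h1.add h2
  rw [integral_add h12 h3, integral_add h1 h2, integral_const_mul, integral_const_mul,
    integral_const_mul,
    integral_prod_mul (μ := γ) (ν := γ) (fun x : ℝ => x ^ 2 * Real.cos (s * x)) (fun _ : ℝ => (1 : ℝ)),
    integral_prod_mul (μ := γ) (ν := γ) (fun x : ℝ => x * Real.cos (s * x)) (fun y : ℝ => y),
    integral_prod_mul (μ := γ) (ν := γ) (fun x : ℝ => Real.cos (s * x)) (fun y : ℝ => y ^ 2),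
    integral_x2_cos, integral_x_cos, integral_cos, integral_x2, integral_x1]
  have hc : ∫ _x : ℝ, (1 : ℝ) ∂γ = 1 := by simp
  rw [hc]
  ring

/-- `E[cos Φ] = e^{−s²/2}` — the perimeter-law-small witness size. [folklore] -/
theorem integral_cosΦ (s : ℝ) : ∫ ξ, Real.cos (s * ξ.1) ∂μ2 = Real.exp (-(s ^ 2 / 2)) := by
  have h := integral_prod_mul (μ := γ) (ν := γ) (fun x : ℝ => Real.cos (s * x)) (fun _ : ℝ => (1 : ℝ))
  simp only [mul_one] at h
  rw [h, integral_cos]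
  simp

/-- `E[Y²] = p² + q²`. [folklore] -/
theorem integral_Y2 (p q : ℝ) : ∫ ξ, (p * ξ.1 + q * ξ.2) ^ 2 ∂μ2 = p ^ 2 + q ^ 2 := by
  have := integral_cos_mul_Y2 0 p q
  simpa using this

/-- `Cov(Φ, Y) = E[Φ Y] = s p`. [folklore] -/
theorem integral_ΦY (s p q : ℝ) : ∫ ξ, (s * ξ.1) * (p * ξ.1 + q * ξ.2) ∂μ2 = s * p := by
  have e : ∀ ξ : ℝ × ℝ, (s * ξ.1) * (p * ξ.1 + q * ξ.2)
      = s * p * (ξ.1 ^ 2 * 1) + s * q * (ξ.1 * ξ.2) := fun ξ => by ring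
  simp_rw [e]
  have h1 : Integrable (fun ξ : ℝ × ℝ => s * p * (ξ.1 ^ 2 * 1)) μ2 :=
    ((integrable_sq_γ.mul_prod (integrable_const (1 : ℝ))).const_mul _)
  have h2 : Integrable (fun ξ : ℝ × ℝ => s * q * (ξ.1 * ξ.2)) μ2 :=
    ((integrable_id_γ.mul_prod integrable_id_γ).const_mul _)
  rw [integral_add h1 h2, integral_const_mul, integral_const_mul,
    integral_prod_mul (μ := γ) (ν := γ) (fun x : ℝ => x ^ 2) (fun _ : ℝ => (1 : ℝ)),
    integral_prod_mul (μ := γ) (ν := γ) (fun x : ℝ => x) (fun y : ℝ => y),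
    integral_x2, integral_x1]
  simp

/-- **The Gaussian static-source response identity** (★):
`Cov(cos Φ, Y²) = −E[cos Φ] · Cov(Φ, Y)²` for the centred Gaussian pair `(Φ, Y) = (sξ₁, pξ₁+qξ₂)`.
The response of a plaquette energy to an abelian static source is, relative to the source's own
expectation, exactly minus the square of the classical (linear-response) field. [folklore] -/
theorem gaussian_staticSource_identity (s p q : ℝ) :
    (∫ ξ, Real.cos (s * ξ.1) * (p * ξ.1 + q * ξ.2) ^ 2 ∂μ2)
      - (∫ ξ, Real.cos (s * ξ.1) ∂μ2) * (∫ ξ, (p * ξ.1 + q * ξ.2) ^ 2 ∂μ2)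
      = -((∫ ξ, Real.cos (s * ξ.1) ∂μ2) * (∫ ξ, (s * ξ.1) * (p * ξ.1 + q * ξ.2) ∂μ2) ^ 2) := by
  rw [integral_cos_mul_Y2, integral_cosΦ, integral_Y2, integral_ΦY]
  ring

/-- **X₁'s witness clause in the free model (the rung)**: a dipole-coupling floor
`Cov(Φ,Y)² ≥ c₁` yields `0 < E[w] ∧ c₁·E[w] ≤ |Cov(w, Y²)|` for the abelian Wilson loop `w = cos Φ`,
with the SAME `c₁` whatever `Var Φ = s²` is — the witness may be arbitrarily (perimeter-law) small,
the certified response ratio is not. [this route] -/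
theorem gaussian_staticSource_floor {c₁ s p q : ℝ} (hc : c₁ ≤ (s * p) ^ 2) :
    0 < ∫ ξ, Real.cos (s * ξ.1) ∂μ2 ∧
    c₁ * ∫ ξ, Real.cos (s * ξ.1) ∂μ2 ≤
      |(∫ ξ, Real.cos (s * ξ.1) * (p * ξ.1 + q * ξ.2) ^ 2 ∂μ2)
        - (∫ ξ, Real.cos (s * ξ.1) ∂μ2) * (∫ ξ, (p * ξ.1 + q * ξ.2) ^ 2 ∂μ2)| := by
  have hpos : 0 < ∫ ξ, Real.cos (s * ξ.1) ∂μ2 := by rw [integral_cosΦ]; exact Real.exp_pos _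
  refine ⟨hpos, ?_⟩
  rw [gaussian_staticSource_identity, integral_ΦY, abs_neg,
    abs_of_nonneg (mul_nonneg hpos.le (sq_nonneg _)), mul_comm]
  exact mul_le_mul_of_nonneg_left hc hpos.le

/-- The witness is exponentially small in the source's variance (perimeter law of the free loop:
`Var Φ ∝ |∂C|/a`), yet the floor above is uniform: the two facts X₁'s normalisation is designed
around, decided in the free model. [this route] -/
theorem gaussian_witness_small (s : ℝ) :
    ∫ ξ, Real.cos (s * ξ.1) ∂μ2 = Real.exp (-(s ^ 2 / 2)) := integral_cosΦ s

/-! ## Part A.4 — ANY centred Gaussian pair `(U, V)`: reduction to the canonical coordinates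

For a pair of real random variables with centred jointly Gaussian law (on any probability space) the
law of `(U, V)` is the image of `μ2 = γ ⊗ γ` under `T_{s,p,q}(ξ) = (s ξ₁, p ξ₁ + q ξ₂)` with
`s² = Var U`, `sp = Cov(U,V)`, `p² + q² = Var V` (Mathlib: a Gaussian measure is determined by its
mean and covariance form, `IsGaussian.ext_covarianceBilinDual`), so (★) holds for `(U, V)`. -/

section GaussianPair

variable {Ω : Type*} [MeasurableSpace Ω] {P : Measure Ω} {U V : Ω → ℝ}

/-- `T_{s,p,q} (ξ₁, ξ₂) = (s ξ₁, p ξ₁ + q ξ₂)` as a continuous linear map. [folklore] -/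
def cholT (s p q : ℝ) : ℝ × ℝ →L[ℝ] ℝ × ℝ :=
  (s • ContinuousLinearMap.fst ℝ ℝ ℝ).prod
    (p • ContinuousLinearMap.fst ℝ ℝ ℝ + q • ContinuousLinearMap.snd ℝ ℝ ℝ)

@[simp] theorem cholT_apply (s p q : ℝ) (ξ : ℝ × ℝ) :
    cholT s p q ξ = (s * ξ.1, p * ξ.1 + q * ξ.2) := by
  simp [cholT]

theorem dual_apply_eq (L : StrongDual ℝ (ℝ × ℝ)) (x : ℝ × ℝ) :
    L x = L (1, 0) * x.1 + L (0, 1) * x.2 := by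
  have hx : x = x.1 • ((1 : ℝ), (0 : ℝ)) + x.2 • ((0 : ℝ), (1 : ℝ)) := by ext <;> simp
  conv_lhs => rw [hx]
  rw [map_add, map_smul, map_smul, smul_eq_mul, smul_eq_mul]
  ring

theorem memLp_two_γ' : MemLp (fun x : ℝ => x) 2 γ := memLp_id_gaussianReal' 2 (by simp)

/-- `Var_{γ⊗γ}(α ξ₁ + β ξ₂) = α² + β²`. [folklore] -/
theorem variance_linear_μ2 (α β : ℝ) :
    Var[fun ξ : ℝ × ℝ => α * ξ.1 + β * ξ.2; μ2] = α ^ 2 + β ^ 2 := by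
  have h : Var[fun ξ : ℝ × ℝ => α * ξ.1 + β * ξ.2; μ2]
      = Var[fun x : ℝ => α * x; γ] + Var[fun y : ℝ => β * y; γ] :=
    variance_add_prod (memLp_two_γ'.const_mul α) (memLp_two_γ'.const_mul β)
  rw [h, variance_const_mul, variance_const_mul, variance_fun_id_gaussianReal]
  simp

instance isGaussian_μ2 : IsGaussian μ2 := by
  unfold μ2 γ; infer_instance

/-- `γ ⊗ γ` is centred. [folklore] -/
theorem integral_μ2_id : ∫ ξ, ξ ∂μ2 = 0 := by
  have hid : Integrable (fun ξ : ℝ × ℝ => ξ) μ2 :=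
    (IsGaussian.memLp_two_id (μ := μ2)).integrable (by norm_num)
  have e : (fun ξ : ℝ × ℝ => ξ) = fun ξ => (ξ.1, ξ.2) := by funext ξ; simp
  rw [e, integral_pair hid.fst hid.snd, integral_fun_fst (fun x : ℝ => x),
    integral_fun_snd (fun y : ℝ => y)]
  simp [integral_id_gaussianReal]

/-- The covariance Cauchy–Schwarz inequality in Cholesky form: canonical coordinates exist.
[folklore] -/
theorem chol_exists (hUV : HasGaussianLaw (fun ω => (U ω, V ω)) P) :
    ∃ s p q : ℝ, s ^ 2 = Var[U; P] ∧ s * p = cov[U, V; P] ∧ p ^ 2 + q ^ 2 = Var[V; P] := by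
  have := hUV.isProbabilityMeasure
  have hUm : MemLp U 2 P := hUV.fst.memLp_two
  have hVm : MemLp V 2 P := hUV.snd.memLp_two
  have hA0 : 0 ≤ Var[U; P] := variance_nonneg _ _
  have hC0 : 0 ≤ Var[V; P] := variance_nonneg _ _
  have hquad : ∀ t : ℝ, 0 ≤ t ^ 2 * Var[U; P] + 2 * (t * cov[U, V; P]) + Var[V; P] := by
    intro t
    have h := variance_nonneg (fun ω => t * U ω + V ω) P
    rwa [variance_fun_add (hUm.const_mul t) hVm, variance_const_mul, covariance_const_mul_left] at h
  by_cases hApos : 0 < Var[U; P]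
  · have hne : Real.sqrt (Var[U; P]) ≠ 0 := (Real.sqrt_pos.2 hApos).ne'
    have hCB : cov[U, V; P] ^ 2 / Var[U; P] ≤ Var[V; P] := by
      have h := hquad (-cov[U, V; P] / Var[U; P])
      have e : (-cov[U, V; P] / Var[U; P]) ^ 2 * Var[U; P]
          + 2 * (-cov[U, V; P] / Var[U; P] * cov[U, V; P]) + Var[V; P]
          = Var[V; P] - cov[U, V; P] ^ 2 / Var[U; P] := by
        field_simp
        ring
      rw [e] at h
      linarith
    refine ⟨Real.sqrt (Var[U; P]), cov[U, V; P] / Real.sqrt (Var[U; P]),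
      Real.sqrt (Var[V; P] - cov[U, V; P] ^ 2 / Var[U; P]), Real.sq_sqrt hA0, ?_, ?_⟩
    · field_simp
    · rw [div_pow, Real.sq_sqrt hA0, Real.sq_sqrt (by linarith)]
      ring
  · have hA : Var[U; P] = 0 := le_antisymm (not_lt.1 hApos) hA0
    have hB : cov[U, V; P] = 0 := by
      by_contra hB
      have h := hquad (-(Var[V; P] + 1) / (2 * cov[U, V; P]))
      rw [hA, mul_zero, zero_add] at h
      have e : 2 * (-(Var[V; P] + 1) / (2 * cov[U, V; P]) * cov[U, V; P]) = -(Var[V; P] + 1) := by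
        field_simp
      rw [e] at h
      linarith
    refine ⟨0, 0, Real.sqrt (Var[V; P]), ?_, ?_, ?_⟩
    · rw [hA]; ring
    · rw [hB]; ring
    · rw [Real.sq_sqrt hC0]; ring

/-- **Canonical coordinates**: the law of a centred Gaussian pair is `(γ ⊗ γ) ∘ T_{s,p,q}⁻¹`.
[folklore] -/
theorem gaussianPair_law_eq (hUV : HasGaussianLaw (fun ω => (U ω, V ω)) P)
    (hU0 : ∫ ω, U ω ∂P = 0) (hV0 : ∫ ω, V ω ∂P = 0) {s p q : ℝ}
    (hs : s ^ 2 = Var[U; P]) (hsp : s * p = cov[U, V; P]) (hpq : p ^ 2 + q ^ 2 = Var[V; P]) :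
    P.map (fun ω => (U ω, V ω)) = μ2.map (cholT s p q) := by
  have := hUV.isProbabilityMeasure
  have hG : IsGaussian (P.map fun ω => (U ω, V ω)) := hUV.isGaussian_map
  have hUm : MemLp U 2 P := hUV.fst.memLp_two
  have hVm : MemLp V 2 P := hUV.snd.memLp_two
  have hid : Integrable (fun ξ : ℝ × ℝ => ξ) μ2 :=
    (IsGaussian.memLp_two_id (μ := μ2)).integrable (by norm_num)
  refine IsGaussian.ext_covarianceBilinDual ?_ ?_
  · rw [integral_map hUV.aemeasurable aestronglyMeasurable_id,
      integral_map (by fun_prop) aestronglyMeasurable_id]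
    simp only [id]
    rw [integral_pair (hUm.integrable (by norm_num)) (hVm.integrable (by norm_num)), hU0, hV0,
      ContinuousLinearMap.integral_comp_comm _ hid, integral_μ2_id, map_zero, Prod.mk_zero_zero]
  · rw [← ContinuousLinearMap.toBilinForm_inj]
    refine LinearMap.BilinForm.ext_of_isSymm isPosSemidef_covarianceBilinDual.isSymm
      isPosSemidef_covarianceBilinDual.isSymm fun L => ?_
    simp only [ContinuousLinearMap.toBilinForm_apply]
    rw [covarianceBilinDual_self_eq_variance IsGaussian.memLp_two_id,
      covarianceBilinDual_self_eq_variance IsGaussian.memLp_two_id,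
      variance_map (by fun_prop) hUV.aemeasurable, variance_map (by fun_prop) (by fun_prop)]
    have e1 : (L : ℝ × ℝ → ℝ) ∘ (fun ω => (U ω, V ω))
        = fun ω => L (1, 0) * U ω + L (0, 1) * V ω := by
      funext ω
      simp only [Function.comp_apply]
      rw [dual_apply_eq]
    have e2 : (L : ℝ × ℝ → ℝ) ∘ (cholT s p q)
        = fun ξ => (L (1, 0) * s + L (0, 1) * p) * ξ.1 + (L (0, 1) * q) * ξ.2 := by
      funext ξ
      simp only [Function.comp_apply, cholT_apply]
      rw [dual_apply_eq]
      ring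
    rw [e1, e2, variance_linear_μ2, variance_fun_add (hUm.const_mul _) (hVm.const_mul _),
      variance_const_mul, variance_const_mul, covariance_const_mul_left,
      covariance_const_mul_right, ← hs, ← hsp, ← hpq]
    ring

/-- Transport of expectations to the canonical coordinates. [folklore] -/
theorem gaussianPair_transport (hUV : HasGaussianLaw (fun ω => (U ω, V ω)) P) {s p q : ℝ}
    (hlaw : P.map (fun ω => (U ω, V ω)) = μ2.map (cholT s p q)) (f : ℝ × ℝ → ℝ)
    (hf : Continuous f) :
    ∫ ω, f (U ω, V ω) ∂P = ∫ ξ, f (s * ξ.1, p * ξ.1 + q * ξ.2) ∂μ2 := by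
  have h1 := integral_map (φ := fun ω => (U ω, V ω)) hUV.aemeasurable
    (hf.aestronglyMeasurable (μ := P.map fun ω => (U ω, V ω)))
  have h2 := integral_map (φ := cholT s p q) (μ := μ2) (by fun_prop)
    (hf.aestronglyMeasurable (μ := μ2.map (cholT s p q)))
  rw [← h1, hlaw, h2]
  simp only [cholT_apply]

/-- **(★) for ANY centred Gaussian pair** on a probability space:
`Cov(cos U, V²) = −E[cos U]·Cov(U,V)²` and `E[cos U] = e^{−Var U/2}`. [folklore] -/
theorem gaussianPair_staticSource_identity (hUV : HasGaussianLaw (fun ω => (U ω, V ω)) P)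
    (hU0 : ∫ ω, U ω ∂P = 0) (hV0 : ∫ ω, V ω ∂P = 0) :
    (∫ ω, Real.cos (U ω) * V ω ^ 2 ∂P) - (∫ ω, Real.cos (U ω) ∂P) * (∫ ω, V ω ^ 2 ∂P)
        = -((∫ ω, Real.cos (U ω) ∂P) * cov[U, V; P] ^ 2) ∧
      ∫ ω, Real.cos (U ω) ∂P = Real.exp (-(Var[U; P] / 2)) := by
  obtain ⟨s, p, q, hs, hsp, hpq⟩ := chol_exists hUV
  have hlaw := gaussianPair_law_eq hUV hU0 hV0 hs hsp hpq
  have E1 : ∫ ω, Real.cos (U ω) * V ω ^ 2 ∂P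
      = ∫ ξ, Real.cos (s * ξ.1) * (p * ξ.1 + q * ξ.2) ^ 2 ∂μ2 :=
    gaussianPair_transport hUV hlaw (fun x => Real.cos x.1 * x.2 ^ 2) (by fun_prop)
  have E2 : ∫ ω, Real.cos (U ω) ∂P = ∫ ξ, Real.cos (s * ξ.1) ∂μ2 :=
    gaussianPair_transport hUV hlaw (fun x => Real.cos x.1) (by fun_prop)
  have E3 : ∫ ω, V ω ^ 2 ∂P = ∫ ξ, (p * ξ.1 + q * ξ.2) ^ 2 ∂μ2 :=
    gaussianPair_transport hUV hlaw (fun x => x.2 ^ 2) (by fun_prop)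
  refine ⟨?_, ?_⟩
  · rw [E1, E2, E3, integral_cos_mul_Y2, integral_cosΦ, integral_Y2, ← hsp]
    ring
  · rw [E2, integral_cosΦ, ← hs]

/-- The ratio floor for ANY centred Gaussian pair: a floor on the linear response `Cov(U,V)² ≥ c₁`
certifies `0 < E[cos U] ∧ c₁·E[cos U] ≤ |Cov(cos U, V²)|`, uniformly in `Var U`. [this route] -/
theorem gaussianPair_staticSource_floor (hUV : HasGaussianLaw (fun ω => (U ω, V ω)) P)
    (hU0 : ∫ ω, U ω ∂P = 0) (hV0 : ∫ ω, V ω ∂P = 0) {c₁ : ℝ} (hc : c₁ ≤ cov[U, V; P] ^ 2) :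
    0 < ∫ ω, Real.cos (U ω) ∂P ∧
    c₁ * ∫ ω, Real.cos (U ω) ∂P ≤
      |(∫ ω, Real.cos (U ω) * V ω ^ 2 ∂P) - (∫ ω, Real.cos (U ω) ∂P) * (∫ ω, V ω ^ 2 ∂P)| := by
  obtain ⟨hid, hcos⟩ := gaussianPair_staticSource_identity hUV hU0 hV0
  have hpos : 0 < ∫ ω, Real.cos (U ω) ∂P := by rw [hcos]; exact Real.exp_pos _
  refine ⟨hpos, ?_⟩
  rw [hid, abs_neg, abs_of_nonneg (mul_nonneg hpos.le (sq_nonneg _)), mul_comm]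
  exact mul_le_mul_of_nonneg_left hc hpos.le

end GaussianPair

/-! ## Part B — the lattice Maxwell field `curvatureGaussianField 4 1` (LANDED layer)

The abelian lattice gauge theory at Gaussian (fixed) coupling: plaquette curvatures `Y_q = ω q 0`
with the Garban–Sepúlveda covariance `dGd*` (tree `curvatureTwoPoint`).  The mirror Wilson loop of
a rectangle is `w = cos Φ_rect`, `Φ_rect = ∑_{p ∈ rect} Y_p` (lattice Stokes), the probe is
`Ṽ_v = ∑_y v(a y) ∑_{q at y} Y_q²`.  Everything below is proved; the deterministic floor
`DipoleEnergyFloor` (stated as a `def` here) is proved in Part C (`dipoleEnergyFloor`). -/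

section Lattice

open Literature.Probability.LatticeModels Literature.MathematicalPhysics.QuantumLattice
  Literature.MathematicalPhysics.QuantumFieldTheory
open Summit.QuantumFields.YangMills.Theorems.SelfNormalisedSkewness.Negative (E4)

/-- The lattice configuration space: `ℝ¹`-valued plaquette `2`-cochains of `ℤ⁴`. [folklore] -/
abbrev Cfg : Type := ZdPlaquette 4 → Fin 1 → ℝ

/-- The lattice Maxwell (curvature Gaussian) field of `ℤ⁴`. [folklore] -/
abbrev μM : Measure Cfg := curvatureGaussianField 4 1

theorem three_le_four : 3 ≤ 4 := by norm_num

instance isProbabilityMeasure_μM : IsProbabilityMeasure μM :=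
  isProbabilityMeasure_curvatureGaussianField three_le_four 1

/-- An oriented coordinate plane `i < j` of `ℤ⁴`. [folklore] -/
abbrev Plane : Type := {p : Fin 4 × Fin 4 // p.1 < p.2}

/-- The plaquettes of the `R × T` rectangle based at `x` in the plane `ij`. [folklore] -/
def rectPlaq (x : Site 4) (ij : Plane) (R T : ℕ) : Finset (ZdPlaquette 4) :=
  (Finset.range R ×ˢ Finset.range T).image
    fun mn => (x + (mn.1 : ℤ) • Pi.single ij.1.1 1 + (mn.2 : ℤ) • Pi.single ij.1.2 1, ij)

/-- The abelian holonomy angle of the source: `Φ_rect = ∑_{p ∈ rect} Y_p` (lattice Stokes). [folklore] -/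
def holonomy (rect : Finset (ZdPlaquette 4)) (ω : Cfg) : ℝ := ∑ p ∈ rect, ω p 0

/-- The abelian Wilson loop `w = cos Φ_rect`. [folklore] -/
def wLoop (rect : Finset (ZdPlaquette 4)) (ω : Cfg) : ℝ := Real.cos (holonomy rect ω)

/-- The classical (linear-response) field of the source at `q`: `∑_{p ∈ rect} (dGd*)(p, q)`. [this route] -/
def dipoleField (rect : Finset (ZdPlaquette 4)) (q : ZdPlaquette 4) : ℝ :=
  ∑ p ∈ rect, curvatureTwoPoint p q

/-- The six plaquettes based at the site `y`. [folklore] -/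
def plaqAt (y : Site 4) : Finset (ZdPlaquette 4) :=
  (Finset.univ : Finset Plane).image fun ij => (y, ij)

/-- The sites of the cube `[-L, L]⁴`. [folklore] -/
def cube (L : ℕ) : Finset (Site 4) :=
  Fintype.piFinset fun _ : Fin 4 => Finset.Icc (-(L : ℤ)) L

/-- The abelian plaquette energy density at `y`: `∑_{q at y} Y_q²` (↦ the crux's `dens`). [folklore] -/
def densA (y : Site 4) (ω : Cfg) : ℝ := ∑ q ∈ plaqAt y, ω q 0 ^ 2

/-- The probe `Ṽ_v = ∑_{y ∈ cube L} v(a y) · densA y` at spacing `a`. [this route] -/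
def probe (a : ℝ) (v : E4 → ℝ) (L : ℕ) (ω : Cfg) : ℝ :=
  ∑ y ∈ cube L, v (a • siteToE y) * densA y ω

/-- The probe-weighted dipole energy `∑_y v(a y) ∑_{q at y} dipoleField²`. [this route] -/
def dipoleEnergy (a : ℝ) (v : E4 → ℝ) (rect : Finset (ZdPlaquette 4)) (L : ℕ) : ℝ :=
  ∑ y ∈ cube L, v (a • siteToE y) * ∑ q ∈ plaqAt y, dipoleField rect q ^ 2

theorem isGaussianProcess_eval : IsGaussianProcess
    (fun (s : ZdPlaquette 4 × Fin 1) (ω : Cfg) => ω s.1 s.2) μM :=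
  isGaussianProcess_eval_curvatureGaussianField three_le_four 1

theorem memLp_eval (p : ZdPlaquette 4) : MemLp (fun ω : Cfg => ω p 0) 2 μM :=
  (isGaussianProcess_eval.hasGaussianLaw_eval (p, 0)).memLp_two

/-- The finite-sum process `A ↦ ∑_{p ∈ A} Y_p` is Gaussian. [folklore] -/
theorem isGaussianProcess_holonomy :
    IsGaussianProcess (fun (A : Finset (ZdPlaquette 4)) (ω : Cfg) => holonomy A ω) μM := by
  classical
  refine isGaussianProcess_eval.of_isGaussianProcess fun A => ?_
  refine ⟨A.image (fun p => (p, (0 : Fin 1))),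
    ∑ t : ↥(A.image fun p => (p, (0 : Fin 1))), ContinuousLinearMap.proj t, fun ω => ?_⟩
  simp only [FunLike.coe_sum, Finset.sum_apply, ContinuousLinearMap.proj_apply,
    Finset.restrict_def]
  rw [Finset.sum_coe_sort (A.image fun p => (p, (0 : Fin 1))) (fun s => ω s.1 s.2),
    Finset.sum_image (fun p _ p' _ h => (Prod.mk.inj h).1)]
  rfl

/-- `(Φ_rect, Y_q)` is a (centred) Gaussian pair under the lattice Maxwell field. [folklore] -/
theorem hasGaussianLaw_holonomy_plaquette (rect : Finset (ZdPlaquette 4)) (q : ZdPlaquette 4) :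
    HasGaussianLaw (fun ω : Cfg => (holonomy rect ω, ω q 0)) μM := by
  have h := isGaussianProcess_holonomy.hasGaussianLaw_prodMk (s := rect) (t := {q})
  simpa [holonomy] using h

theorem integral_eval (p : ZdPlaquette 4) : ∫ ω, ω p 0 ∂μM = 0 :=
  integral_eval_curvatureGaussianField three_le_four 1 p 0

theorem integral_holonomy (rect : Finset (ZdPlaquette 4)) : ∫ ω, holonomy rect ω ∂μM = 0 := by
  simp only [holonomy]
  rw [integral_finsetSum rect fun p _ => (memLp_eval p).integrable (by norm_num)]
  exact Finset.sum_eq_zero fun p _ => integral_eval p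

/-- **Lattice linear response**: `Cov(Φ_rect, Y_q) = dipoleField rect q`. [this route] -/
theorem cov_holonomy_plaquette (rect : Finset (ZdPlaquette 4)) (q : ZdPlaquette 4) :
    cov[holonomy rect, fun ω => ω q 0; μM] = dipoleField rect q := by
  show cov[fun ω => ∑ p ∈ rect, ω p 0, fun ω => ω q 0; μM] = _
  rw [covariance_fun_sum_left' (fun p _ => memLp_eval p) (memLp_eval q), dipoleField]
  refine Finset.sum_congr rfl fun p _ => ?_
  rw [covariance_eval_curvatureGaussianField three_le_four 1 p q 0 0, if_pos rfl]

/-- **(★) on the lattice**: `Cov_μ(w, Y_q²) = −E_μ[w] · dipoleField(q)²` for the abelian Wilson loop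
`w = cos Φ_rect` of ANY finite plaquette set and ANY plaquette `q`. [this route] -/
theorem latticeMaxwell_plaquette_response (rect : Finset (ZdPlaquette 4)) (q : ZdPlaquette 4) :
    (∫ ω, wLoop rect ω * ω q 0 ^ 2 ∂μM) - (∫ ω, wLoop rect ω ∂μM) * (∫ ω, ω q 0 ^ 2 ∂μM)
      = -((∫ ω, wLoop rect ω ∂μM) * dipoleField rect q ^ 2) := by
  have h := (gaussianPair_staticSource_identity (hasGaussianLaw_holonomy_plaquette rect q)
    (integral_holonomy rect) (integral_eval q)).1
  rw [cov_holonomy_plaquette] at h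
  exact h

/-- `E_μ[w] = e^{−Var Φ_rect/2} > 0` (perimeter-small but positive). [this route] -/
theorem latticeMaxwell_wLoop_eq (rect : Finset (ZdPlaquette 4)) :
    ∫ ω, wLoop rect ω ∂μM = Real.exp (-(Var[holonomy rect; μM] / 2)) :=
  (gaussianPair_staticSource_identity (V := fun ω => ω (plaquette12 three_le_four 0) 0)
    (hasGaussianLaw_holonomy_plaquette rect _) (integral_holonomy rect) (integral_eval _)).2

theorem latticeMaxwell_wLoop_pos (rect : Finset (ZdPlaquette 4)) : 0 < ∫ ω, wLoop rect ω ∂μM := by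
  rw [latticeMaxwell_wLoop_eq]; exact Real.exp_pos _

theorem abs_wLoop_le (rect : Finset (ZdPlaquette 4)) (ω : Cfg) : |wLoop rect ω| ≤ 1 :=
  Real.abs_cos_le_one _

theorem integrable_sq_eval (q : ZdPlaquette 4) : Integrable (fun ω : Cfg => ω q 0 ^ 2) μM :=
  (memLp_eval q).integrable_sq

theorem integrable_wLoop_mul_sq (rect : Finset (ZdPlaquette 4)) (q : ZdPlaquette 4) :
    Integrable (fun ω : Cfg => wLoop rect ω * ω q 0 ^ 2) μM := by
  refine (integrable_sq_eval q).mono' ?_ (Filter.Eventually.of_forall fun ω => ?_)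
  · have hm : AEStronglyMeasurable (fun ω : Cfg => wLoop rect ω) μM := by
      have : Measurable fun ω : Cfg => holonomy rect ω :=
        Finset.measurable_sum _ fun p _ => (measurable_pi_apply 0).comp (measurable_pi_apply p)
      exact (Real.continuous_cos.measurable.comp this).aestronglyMeasurable
    exact hm.mul (integrable_sq_eval q).aestronglyMeasurable
  · rw [norm_mul, Real.norm_eq_abs, Real.norm_eq_abs, abs_pow, sq_abs]
    exact mul_le_of_le_one_left (sq_nonneg _) (abs_wLoop_le rect ω)

theorem integrable_wLoop (rect : Finset (ZdPlaquette 4)) : Integrable (fun ω : Cfg => wLoop rect ω) μM := by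
  refine (integrable_const (1 : ℝ)).mono' ?_ (Filter.Eventually.of_forall fun ω => ?_)
  · have : Measurable fun ω : Cfg => holonomy rect ω :=
      Finset.measurable_sum _ fun p _ => (measurable_pi_apply 0).comp (measurable_pi_apply p)
    exact (Real.continuous_cos.measurable.comp this).aestronglyMeasurable
  · simpa [Real.norm_eq_abs] using abs_wLoop_le rect ω

/-- **The summed response identity**: `Cov_μ(w, Ṽ_v) = −E_μ[w] · dipoleEnergy` — the
`E[w]`-normalised response of the probe to the static source is EXACTLY minus its classical field
energy, for every spacing `a`, probe `v`, rectangle and volume cut-off `L`. [this route] -/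
theorem latticeMaxwell_probe_response (a : ℝ) (v : E4 → ℝ) (rect : Finset (ZdPlaquette 4)) (L : ℕ) :
    (∫ ω, wLoop rect ω * probe a v L ω ∂μM) - (∫ ω, wLoop rect ω ∂μM) * (∫ ω, probe a v L ω ∂μM)
      = -((∫ ω, wLoop rect ω ∂μM) * dipoleEnergy a v rect L) := by
  -- linearity of the three expectations over the finite sums, then (★) termwise
  have e1 : ∫ ω, wLoop rect ω * probe a v L ω ∂μM
      = ∑ y ∈ cube L, v (a • siteToE y) * ∑ q ∈ plaqAt y, ∫ ω, wLoop rect ω * ω q 0 ^ 2 ∂μM := by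
    have : ∀ ω : Cfg, wLoop rect ω * probe a v L ω
        = ∑ y ∈ cube L, v (a • siteToE y) * ∑ q ∈ plaqAt y, wLoop rect ω * ω q 0 ^ 2 := by
      intro ω
      simp only [probe, densA, Finset.mul_sum]
      refine Finset.sum_congr rfl fun y _ => Finset.sum_congr rfl fun q _ => ?_
      ring
    simp_rw [this]
    rw [integral_finsetSum _ fun y _ => ?_]
    · refine Finset.sum_congr rfl fun y _ => ?_
      rw [integral_const_mul, integral_finsetSum _ fun q _ => integrable_wLoop_mul_sq rect q]
    · exact (integrable_finsetSum _ fun q _ => integrable_wLoop_mul_sq rect q).const_mul _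
  have e2 : ∫ ω, probe a v L ω ∂μM
      = ∑ y ∈ cube L, v (a • siteToE y) * ∑ q ∈ plaqAt y, ∫ ω, ω q 0 ^ 2 ∂μM := by
    simp only [probe, densA]
    rw [integral_finsetSum _ fun y _ => ?_]
    · refine Finset.sum_congr rfl fun y _ => ?_
      rw [integral_const_mul, integral_finsetSum _ fun q _ => integrable_sq_eval q]
    · exact (integrable_finsetSum _ fun q _ => integrable_sq_eval q).const_mul _
  have key : ∀ y : Site 4,
      (∑ q ∈ plaqAt y, ∫ ω, wLoop rect ω * ω q 0 ^ 2 ∂μM)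
        - (∫ ω, wLoop rect ω ∂μM) * ∑ q ∈ plaqAt y, ∫ ω, ω q 0 ^ 2 ∂μM
        = -((∫ ω, wLoop rect ω ∂μM) * ∑ q ∈ plaqAt y, dipoleField rect q ^ 2) := by
    intro y
    rw [Finset.mul_sum, Finset.mul_sum, ← Finset.sum_sub_distrib, ← Finset.sum_neg_distrib]
    exact Finset.sum_congr rfl fun q _ => latticeMaxwell_plaquette_response rect q
  rw [e1, e2, dipoleEnergy, Finset.mul_sum, Finset.mul_sum, ← Finset.sum_sub_distrib,
    ← Finset.sum_neg_distrib]
  refine Finset.sum_congr rfl fun y _ => ?_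
  rw [mul_left_comm (∫ ω, wLoop rect ω ∂μM) (v (a • siteToE y)), ← mul_sub, key y]
  ring

/-- **The deterministic floor** (PROVED in Part C, `dipoleEnergyFloor`; = the former plan-only
`stub_rung_dipoleEnergyFloor`): a probe of every window size `ℓ` and constants `c₁, a₀ > 0` such that for
all spacings `a ≤ a₀` and volumes `L` with `ℓ ≤ aL` some mirror rectangle strictly inside `{y₀ < 0}`
within physical distance `ℓ` has probe-weighted classical field energy `≥ c₁`. [this route] -/
def DipoleEnergyFloor : Prop :=
  ∀ ℓ : ℝ, 0 < ℓ → ∃ (v : SchwartzMap E4 ℝ) (c₁ a₀ : ℝ),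
    tsupport (v : E4 → ℝ) ⊆ {y | 0 < y 0} ∧ tsupport (v : E4 → ℝ) ⊆ Metric.closedBall 0 ℓ ∧
    (v : E4 → ℝ) ≠ 0 ∧ (∀ z, 0 ≤ v z) ∧ 0 < c₁ ∧ 0 < a₀ ∧
    ∀ a : ℝ, 0 < a → a ≤ a₀ → ∀ L : ℕ, ℓ ≤ a * L →
      ∃ (x : Site 4) (ij : Plane) (R T : ℕ), 1 ≤ R ∧ 1 ≤ T ∧
        ((x 0 : ℤ) + R + T ≤ -1) ∧ (-ℓ ≤ a * (x 0 : ℝ)) ∧ (∀ k, |(x k : ℝ)| * a ≤ ℓ) ∧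
        c₁ ≤ dipoleEnergy a (v : E4 → ℝ) (rectPlaq x ij R T) L

/-- **X₁'s instance in lattice Maxwell theory, RATIO form, reduced to the deterministic floor**:
for every rectangle/probe with `c₁ ≤ dipoleEnergy`, the static-source witness clause of
`StaticSourceResponse` holds verbatim — `0 < E[w]` and `c₁ · E[w] ≤ |Cov(w, Ṽ_v)|` — with the same
`c₁` (no loss from the perimeter-small `E[w]`). [this route] -/
theorem latticeMaxwell_X1_of_floor {a c₁ : ℝ} {v : E4 → ℝ} {rect : Finset (ZdPlaquette 4)} {L : ℕ}
    (hfloor : c₁ ≤ dipoleEnergy a v rect L) :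
    0 < ∫ ω, wLoop rect ω ∂μM ∧
    c₁ * ∫ ω, wLoop rect ω ∂μM ≤
      |(∫ ω, wLoop rect ω * probe a v L ω ∂μM)
        - (∫ ω, wLoop rect ω ∂μM) * (∫ ω, probe a v L ω ∂μM)| := by
  have hpos := latticeMaxwell_wLoop_pos rect
  refine ⟨hpos, ?_⟩
  rw [latticeMaxwell_probe_response, abs_neg, abs_mul, abs_of_pos hpos]
  calc c₁ * ∫ ω, wLoop rect ω ∂μM
      ≤ |dipoleEnergy a v rect L| * ∫ ω, wLoop rect ω ∂μM :=
        mul_le_mul_of_nonneg_right (hfloor.trans (le_abs_self _)) hpos.le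
    _ = (∫ ω, wLoop rect ω ∂μM) * |dipoleEnergy a v rect L| := mul_comm _ _

/-- **The lattice-Maxwell rung of X₁, conditional only on the deterministic floor**: the X₁-shaped
statement (probe per window; `c₁` uniform in the spacing `a ≤ a₀` and in `L`; a mirror rectangle
in `{y₀ < 0}`; `0 < E[w] ∧ c₁·E[w] ≤ |Cov(w, Ṽ_v)|`) in the abelian theory at fixed coupling.
[this route] -/
theorem latticeMaxwell_staticSourceResponse_of_floor (hF : DipoleEnergyFloor) :
    ∀ ℓ : ℝ, 0 < ℓ → ∃ (v : SchwartzMap E4 ℝ) (c₁ a₀ : ℝ),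
      tsupport (v : E4 → ℝ) ⊆ {y | 0 < y 0} ∧ tsupport (v : E4 → ℝ) ⊆ Metric.closedBall 0 ℓ ∧
      (v : E4 → ℝ) ≠ 0 ∧ 0 < c₁ ∧ 0 < a₀ ∧
      ∀ a : ℝ, 0 < a → a ≤ a₀ → ∀ L : ℕ, ℓ ≤ a * L →
        ∃ (x : Site 4) (ij : Plane) (R T : ℕ), 1 ≤ R ∧ 1 ≤ T ∧
          ((x 0 : ℤ) + R + T ≤ -1) ∧ (-ℓ ≤ a * (x 0 : ℝ)) ∧ (∀ k, |(x k : ℝ)| * a ≤ ℓ) ∧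
          0 < ∫ ω, wLoop (rectPlaq x ij R T) ω ∂μM ∧
          c₁ * ∫ ω, wLoop (rectPlaq x ij R T) ω ∂μM ≤
            |(∫ ω, wLoop (rectPlaq x ij R T) ω * probe a (v : E4 → ℝ) L ω ∂μM)
              - (∫ ω, wLoop (rectPlaq x ij R T) ω ∂μM) * (∫ ω, probe a (v : E4 → ℝ) L ω ∂μM)| := by
  intro ℓ hℓ
  obtain ⟨v, c₁, a₀, h1, h2, h3, _h4, h5, h6, h7⟩ := hF ℓ hℓ
  refine ⟨v, c₁, a₀, h1, h2, h3, h5, h6, fun a ha ha₀ L hL => ?_⟩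
  obtain ⟨x, ij, R, T, hR, hT, g1, g2, g3, hfl⟩ := h7 a ha ha₀ L hL
  exact ⟨x, ij, R, T, hR, hT, g1, g2, g3, latticeMaxwell_X1_of_floor hfl⟩

end Lattice

/-! ## Part A.3 — separation: S's clause (ii) is FALSE in the free abelian model -/

open scoped SchwartzMap in
open Summit.QuantumFields.YangMills.Theorems.SelfNormalisedSkewness.Negative in
/-- In the free Maxwell₄ model (tree `maxwellKernel`; same universality class as the Gaussian pair
above) the connected three-point functional of the plaquette energy `F²` is `8·maxwellRing3 ≡ 0`
(`maxwellRing3_eq_zero`), so NT's clause (ii) floor admits no `ε > 0`: S's analogue is decided FALSE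
where X₁'s analogue (★) is decided TRUE. [this route] -/
theorem freeAbelian_NT_clauseII_false :
    ¬ ∃ (f g h : 𝓢(E4, ℝ)) (ε : ℝ), 0 < ε ∧ ε ≤ |8 * maxwellRing3 f g h| := by
  rintro ⟨f, g, h, ε, hε, hle⟩
  rw [maxwellRing3_eq_zero] at hle
  norm_num at hle
  linarith


/-! ## Part C — the dipole-energy floor, PROVED (v3): lattice potential theory of the static source

`curvatureTwoPoint (x,(1,2)) (y,(1,2)) = −(Δ₁G + Δ₂G)(x − y)/2` (tree closed form), and Lawler (1.37)
at `d = 4` gives `ΔᵢG(z) = −(1/π²)(1/|z|⁴ − 4zᵢ²/|z|⁶) + O(|z|⁻⁵)`, so on the cone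
`4(z₁² + z₂²) ≤ |z|²`, `|z| ≥ R₀`, the parallel kernel is `≥ 1/(4π²|z|⁴) > 0` (`kernel_cone_lower`).
The hyperscaling configuration (`dipoleEnergyFloor`): `N = ⌊ℓ/(64a)⌋ ≥ R₀`, `X = ⌊ℓ/(2a)⌋ ∈ [32N, 64N]`,
source `rectPlaq (−X e₀) (1,2) N N`, probe the bump `wfun ℓ` (centre `(ℓ/2)e₀`, radii `ℓ/8, ℓ/4`,
`≡ 1` on the box `X e₀ + [−N,N]⁴`, support in `{y₀ ≥ ℓ/4} ∩ B(0, 3ℓ/4)`); every source–probe pair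
lies in the cone with `|z|² ≤ 16650 N²`, so `dipoleField ≥ N²/(4π²(16650N²)²)` on the box and
`dipoleEnergy ≥ (2N+1)⁴ · (N²·k_min)² ≥ 1/(16π⁴·16650⁴) =: c₁`, uniformly in `a ≤ a₀ := ℓ/(128R₀)`, `L`.
NOTHING here proves the YM mass gap or NT: this is the free abelian model's instance of X₁. -/

section Floor

open Literature.Probability.LatticeModels Literature.MathematicalPhysics.QuantumLattice
  Literature.MathematicalPhysics.QuantumFieldTheory
open Metric Set
open Summit.QuantumFields.YangMills.Theorems.SelfNormalisedSkewness.Negative (E4 e₀)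

/-- The `(1,2)` coordinate plane. -/
def P12 : {p : Fin 4 × Fin 4 // p.1 < p.2} := ⟨((1 : Fin 4), (2 : Fin 4)), by decide⟩

/-- squared Euclidean length of a site -/
def S (z : Site 4) : ℝ := ∑ j, ((z j : ℤ) : ℝ) ^ 2

theorem S_eq (z : Site 4) : S z = ((z 0 : ℤ) : ℝ) ^ 2 + ((z 1 : ℤ) : ℝ) ^ 2 + ((z 2 : ℤ) : ℝ) ^ 2 + ((z 3 : ℤ) : ℝ) ^ 2 := by
  simp [S, Fin.sum_univ_four]

theorem S_nonneg (z : Site 4) : 0 ≤ S z := Finset.sum_nonneg fun _ _ => sq_nonneg _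

/-- closed form: parallel `(1,2)` plaquettes -/
theorem curvatureTwoPoint_P12 (x y : Site 4) :
    curvatureTwoPoint (x, P12) (y, P12) =
      -((latticeGreen (x - y + Pi.single 1 1) + latticeGreen (x - y - Pi.single 1 1) - 2 * latticeGreen (x - y)) +
        (latticeGreen (x - y + Pi.single 2 1) + latticeGreen (x - y - Pi.single 2 1) - 2 * latticeGreen (x - y))) / 2 := by
  rw [Summit.QuantumFields.YangMills.Theorems.WeakCouplingRates.curvatureTwoPoint_eq_curl_greenTensor]
  have h := Summit.QuantumFields.YangMills.Theorems.WeakCouplingRates.curl_greenTensor_parallel y x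
    (by decide : (1 : Fin 4) ≠ 2)
  simp only [P12] at h ⊢
  rw [h]


/-- Lawler (1.37) at `d = 4` in the normalisation used here:
`|Δ_iG(z) + (1/π²)(1/S² - 4 zᵢ²/S³)| ≤ K/(S²√S)`, `S = |z|²`, all `z ≠ 0`. -/
theorem secondDiff_asymp : ∃ K : ℝ, 0 ≤ K ∧ ∀ z : Site 4, z ≠ 0 → ∀ i : Fin 4,
    |latticeGreen (z + Pi.single i 1) + latticeGreen (z - Pi.single i 1) - 2 * latticeGreen z +
        (1 / π ^ 2) * (1 / S z ^ 2 - 4 * ((z i : ℤ) : ℝ) ^ 2 / S z ^ 3)| ≤ K / (S z ^ 2 * Real.sqrt (S z)) := by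
  obtain ⟨K, hK0, hK⟩ := latticeGreen_second_diff_continuum (d := 4) (by norm_num)
  refine ⟨K, hK0, fun z hz i => ?_⟩
  have h := hK z hz i
  have hSpos : 0 < S z := by
    rcases Function.ne_iff.mp hz with ⟨j, hj⟩
    have hj' : ((z j : ℤ) : ℝ) ≠ 0 := by exact_mod_cast hj
    have : 0 < ((z j : ℤ) : ℝ) ^ 2 := by positivity
    exact lt_of_lt_of_le this (Finset.single_le_sum (f := fun j => ((z j : ℤ) : ℝ) ^ 2)
      (fun _ _ => sq_nonneg _) (Finset.mem_univ j))
  have hs : Real.sqrt (∑ j, ((z j : ℤ) : ℝ) ^ 2) = Real.sqrt (S z) := rfl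
  set r := Real.sqrt (S z) with hr
  have hrpos : 0 < r := Real.sqrt_pos.mpr hSpos
  have hr2 : r ^ 2 = S z := Real.sq_sqrt hSpos.le
  have ha : Real.Gamma (((4 : ℕ) : ℝ) / 2 - 1) / (2 * π ^ (((4 : ℕ) : ℝ) / 2)) = 1 / (2 * π ^ 2) := by
    have h1 : (((4 : ℕ) : ℝ) / 2 - 1) = 1 := by norm_num
    have h2 : (((4 : ℕ) : ℝ) / 2) = ((2 : ℕ) : ℝ) := by norm_num
    rw [h1, h2, Real.Gamma_one, Real.rpow_natCast]
  have hpow4 : r ^ (-((4 : ℕ) : ℝ)) = 1 / S z ^ 2 := by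
    rw [Real.rpow_neg hrpos.le, Real.rpow_natCast, one_div, ← hr2]; ring
  have hpow6 : r ^ (-(((4 : ℕ) : ℝ) + 2)) = 1 / S z ^ 3 := by
    rw [show (-(((4 : ℕ) : ℝ) + 2)) = -((6 : ℕ) : ℝ) by norm_num, Real.rpow_neg hrpos.le, Real.rpow_natCast,
      one_div, ← hr2]; ring
  have hpow5 : r ^ (-(((4 : ℕ) : ℝ) + 1)) = 1 / (S z ^ 2 * r) := by
    rw [show (-(((4 : ℕ) : ℝ) + 1)) = -((5 : ℕ) : ℝ) by norm_num, Real.rpow_neg hrpos.le, Real.rpow_natCast,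
      one_div, ← hr2]; ring
  rw [hs, ha, hpow4, hpow6, hpow5] at h
  have e4 : (2 - ((4 : ℕ) : ℝ)) = -2 := by norm_num
  rw [e4] at h
  have key : latticeGreen (z + Pi.single i 1) + latticeGreen (z - Pi.single i 1) - 2 * latticeGreen z +
        1 / π ^ 2 * (1 / S z ^ 2 - 4 * ((z i : ℤ) : ℝ) ^ 2 / S z ^ 3) =
      latticeGreen (z + Pi.single i 1) + latticeGreen (z - Pi.single i 1) - 2 * latticeGreen z -
        1 / (2 * π ^ 2) * (-2 * (1 / S z ^ 2 - (4 : ℕ) * ((z i : ℤ) : ℝ) ^ 2 * (1 / S z ^ 3))) := by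
    push_cast; ring
  rw [key]
  have e5 : K * (1 / (S z ^ 2 * r)) = K / (S z ^ 2 * r) := by ring
  rw [e5] at h
  exact h


theorem S_sub (x y : Site 4) : S (x - y) = ∑ j, (((x j : ℤ) : ℝ) - ((y j : ℤ) : ℝ)) ^ 2 := by
  simp [S]

theorem S_pos_of_ne {z : Site 4} (hz : z ≠ 0) : 0 < S z := by
  rcases Function.ne_iff.mp hz with ⟨j, hj⟩
  have hj' : ((z j : ℤ) : ℝ) ≠ 0 := by exact_mod_cast hj
  have : 0 < ((z j : ℤ) : ℝ) ^ 2 := by positivity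
  exact lt_of_lt_of_le this (Finset.single_le_sum (f := fun j => ((z j : ℤ) : ℝ) ^ 2)
    (fun _ _ => sq_nonneg _) (Finset.mem_univ j))

theorem ne_zero_of_S_pos {z : Site 4} (h : 0 < S z) : z ≠ 0 := by
  rintro rfl
  simp [S] at h

/-- **Far-field positivity of the parallel-plaquette curvature kernel in the transverse cone.**
There is `R₀ ≥ 1` such that for all sites `x, y` with `z = x − y` in the cone `4(z₁² + z₂²) ≤ |z|²`
and `|z| ≥ R₀`: `curvatureTwoPoint (x;1,2) (y;1,2) ≥ 1/(4π²|z|⁴)`. -/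
theorem kernel_cone_lower : ∃ R₀ : ℝ, 1 ≤ R₀ ∧ ∀ x y : Site 4,
    4 * ((((x - y) 1 : ℤ) : ℝ) ^ 2 + (((x - y) 2 : ℤ) : ℝ) ^ 2) ≤ S (x - y) → R₀ ^ 2 ≤ S (x - y) →
      1 / (4 * π ^ 2 * S (x - y) ^ 2) ≤ curvatureTwoPoint (x, P12) (y, P12) := by
  obtain ⟨K, hK0, hK⟩ := secondDiff_asymp
  refine ⟨4 * π ^ 2 * K + 1, by nlinarith [Real.pi_pos, mul_nonneg (sq_nonneg π) hK0], fun x y hcone hfar => ?_⟩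
  set z : Site 4 := x - y with hz
  have hR0pos : 0 < 4 * π ^ 2 * K + 1 := by positivity
  have hSpos : 0 < S z := lt_of_lt_of_le (by positivity) hfar
  have hz0 : z ≠ 0 := ne_zero_of_S_pos hSpos
  set s := S z with hs
  set r := Real.sqrt s with hr
  have hrpos : 0 < r := Real.sqrt_pos.mpr hSpos
  have hrR : 4 * π ^ 2 * K + 1 ≤ r := by
    have : Real.sqrt ((4 * π ^ 2 * K + 1) ^ 2) ≤ Real.sqrt s := Real.sqrt_le_sqrt hfar
    rwa [Real.sqrt_sq hR0pos.le] at this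
  have h1 := hK z hz0 1
  have h2 := hK z hz0 2
  rw [curvatureTwoPoint_P12, ← hz]
  set A1 := latticeGreen (z + Pi.single 1 1) + latticeGreen (z - Pi.single 1 1) - 2 * latticeGreen z with hA1
  set A2 := latticeGreen (z + Pi.single 2 1) + latticeGreen (z - Pi.single 2 1) - 2 * latticeGreen z with hA2
  set q : ℝ := ((z 1 : ℤ) : ℝ) ^ 2 + ((z 2 : ℤ) : ℝ) ^ 2 with hq
  -- the main term
  have hmain : 1 / (2 * π ^ 2 * s ^ 2) ≤
      (1 / π ^ 2 * (1 / s ^ 2 - 4 * ((z 1 : ℤ) : ℝ) ^ 2 / s ^ 3) +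
        1 / π ^ 2 * (1 / s ^ 2 - 4 * ((z 2 : ℤ) : ℝ) ^ 2 / s ^ 3)) / 2 := by
    have hq' : 4 * q ≤ s := hcone
    have e : (1 / π ^ 2 * (1 / s ^ 2 - 4 * ((z 1 : ℤ) : ℝ) ^ 2 / s ^ 3) +
        1 / π ^ 2 * (1 / s ^ 2 - 4 * ((z 2 : ℤ) : ℝ) ^ 2 / s ^ 3)) / 2 = 1 / π ^ 2 * (1 / s ^ 2 - 2 * q / s ^ 3) := by
      rw [hq]; ring
    rw [e]
    have hq2 : 2 * q / s ^ 3 ≤ 1 / (2 * s ^ 2) := by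
      rw [div_le_div_iff₀ (by positivity) (by positivity)]
      nlinarith [hSpos, sq_nonneg s]
    have hpi : 0 < 1 / π ^ 2 := by positivity
    have e2 : 1 / (2 * π ^ 2 * s ^ 2) = 1 / π ^ 2 * (1 / s ^ 2 - 1 / (2 * s ^ 2)) := by
      field_simp; ring
    rw [e2]
    exact mul_le_mul_of_nonneg_left (by linarith) hpi.le
  -- the error term
  have herr : K / (s ^ 2 * r) ≤ 1 / (4 * π ^ 2 * s ^ 2) := by
    rw [div_le_div_iff₀ (by positivity) (by positivity)]
    have : 4 * π ^ 2 * K ≤ r := by linarith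
    nlinarith [sq_nonneg s, hSpos]
  have e3 : 1 / (2 * π ^ 2 * s ^ 2) - 1 / (4 * π ^ 2 * s ^ 2) = 1 / (4 * π ^ 2 * s ^ 2) := by
    field_simp; ring
  have hb1 := (abs_le.mp h1).2
  have hb2 := (abs_le.mp h2).2
  linarith


/-! ## pure arithmetic: the separation geometry -/

theorem sq_le_of_abs_le {t B : ℝ} (h : |t| ≤ B) : t ^ 2 ≤ B ^ 2 :=
  sq_le_sq' (abs_le.mp h).1 (abs_le.mp h).2

/-- The separation vector `z = (−X − y₀, m − y₁, n − y₂, −y₃)` between a plaquette of the source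
(`0 ≤ m, n ≤ N`) and a probe site (`|y₀ − X|, |y_k| ≤ N`), `32N ≤ X ≤ 64N`: it lies in the transverse
cone, is far (`≥ N`) and not too far (`|z|² ≤ 16650 N²`). -/
theorem geom {X N m n y0 y1 y2 y3 : ℝ} (hN : 1 ≤ N) (hX1 : 32 * N ≤ X) (hX2 : X ≤ 64 * N)
    (hm0 : 0 ≤ m) (hmN : m ≤ N) (hn0 : 0 ≤ n) (hnN : n ≤ N)
    (hy0 : |y0 - X| ≤ N) (hy1 : |y1| ≤ N) (hy2 : |y2| ≤ N) (hy3 : |y3| ≤ N) :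
    4 * ((m - y1) ^ 2 + (n - y2) ^ 2) ≤ (-X - y0) ^ 2 + (m - y1) ^ 2 + (n - y2) ^ 2 + (-y3) ^ 2 ∧
    N ^ 2 ≤ (-X - y0) ^ 2 + (m - y1) ^ 2 + (n - y2) ^ 2 + (-y3) ^ 2 ∧
    (-X - y0) ^ 2 + (m - y1) ^ 2 + (n - y2) ^ 2 + (-y3) ^ 2 ≤ 16650 * N ^ 2 := by
  have h1 : |m - y1| ≤ 2 * N := by
    rw [abs_le] at hy1 ⊢; constructor <;> linarith
  have h2 : |n - y2| ≤ 2 * N := by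
    rw [abs_le] at hy2 ⊢; constructor <;> linarith
  have h3 : |(-y3)| ≤ N := by rw [abs_neg]; exact hy3
  have h0u : |(-X - y0)| ≤ 129 * N := by
    rw [abs_le] at hy0 ⊢; constructor <;> linarith
  have h0l : 63 * N ≤ |(-X - y0)| := by
    rw [abs_le] at hy0
    rw [le_abs]; right; linarith
  have s1 := sq_le_of_abs_le h1
  have s2 := sq_le_of_abs_le h2
  have s3 := sq_le_of_abs_le h3
  have s0u := sq_le_of_abs_le h0u
  have s0l : (63 * N) ^ 2 ≤ (-X - y0) ^ 2 := by
    have := sq_le_sq' (by linarith [abs_nonneg (-X - y0)]) h0l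
    rwa [sq_abs] at this
  refine ⟨by nlinarith, by nlinarith, by nlinarith⟩

/-! ## the probe: a bump at `(ℓ/2)e₀` (as in the FRM rung) -/

/-- Centre of the probe at scale `ℓ`. -/
def ctr (ℓ : ℝ) : E4 := (ℓ / 2) • e₀

theorem ctr_apply (ℓ : ℝ) (k : Fin 4) : ctr ℓ k = if k = 0 then ℓ / 2 else 0 := by
  simp [ctr, e₀]

theorem abs_apply_le_norm (z : E4) (i : Fin 4) : |z i| ≤ ‖z‖ := by
  simpa [Real.norm_eq_abs] using PiLp.norm_apply_le z i

theorem norm_e₀ : ‖e₀‖ = 1 := by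
  have h : ‖e₀‖ ^ 2 = 1 := by
    rw [EuclideanSpace.real_norm_sq_eq]; simp [e₀]
  have h' : ‖e₀‖ ^ 2 = 1 ^ 2 := by rw [h, one_pow]
  exact (pow_left_inj₀ (norm_nonneg e₀) zero_le_one two_ne_zero).1 h'

theorem norm_ctr {ℓ : ℝ} (hℓ : 0 ≤ ℓ) : ‖ctr ℓ‖ = ℓ / 2 := by
  rw [ctr, norm_smul, norm_e₀, Real.norm_of_nonneg (by linarith), mul_one]

/-- The smooth bump at scale `ℓ`: `= 1` on `B̄(c_ℓ, ℓ/8)`, supported in `B̄(c_ℓ, ℓ/4)`. -/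
def bump (ℓ : ℝ) (hℓ : 0 < ℓ) : ContDiffBump (ctr ℓ) :=
  ⟨ℓ / 8, ℓ / 4, by positivity, by linarith⟩

@[simp] theorem bump_rIn (ℓ : ℝ) (hℓ : 0 < ℓ) : (bump ℓ hℓ).rIn = ℓ / 8 := rfl
@[simp] theorem bump_rOut (ℓ : ℝ) (hℓ : 0 < ℓ) : (bump ℓ hℓ).rOut = ℓ / 4 := rfl

/-- The probe as a Schwartz test function. -/
def wfun (ℓ : ℝ) (hℓ : 0 < ℓ) : SchwartzMap E4 ℝ :=
  (bump ℓ hℓ).hasCompactSupport.toSchwartzMap (bump ℓ hℓ).contDiff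

@[simp] theorem wfun_apply (ℓ : ℝ) (hℓ : 0 < ℓ) (x : E4) : wfun ℓ hℓ x = bump ℓ hℓ x := rfl

section Scale
variable {ℓ : ℝ} (hℓ : 0 < ℓ)

theorem time_lower_of_mem {x : E4} (hx : x ∈ closedBall (ctr ℓ) (ℓ / 4)) : ℓ / 4 ≤ x 0 := by
  rw [mem_closedBall, dist_eq_norm] at hx
  have h1 : |(x - ctr ℓ) 0| ≤ ‖x - ctr ℓ‖ := abs_apply_le_norm _ 0
  have h2 : (x - ctr ℓ) 0 = x 0 - ℓ / 2 := by simp [ctr_apply]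
  rw [h2] at h1
  have := (abs_le.mp (h1.trans hx)).1
  linarith

include hℓ in
theorem norm_le_of_mem {x : E4} (hx : x ∈ closedBall (ctr ℓ) (ℓ / 4)) : ‖x‖ ≤ 3 * ℓ / 4 := by
  rw [mem_closedBall, dist_eq_norm] at hx
  have hc : ‖ctr ℓ‖ = ℓ / 2 := norm_ctr hℓ.le
  calc ‖x‖ = ‖(x - ctr ℓ) + ctr ℓ‖ := by rw [sub_add_cancel]
    _ ≤ ‖x - ctr ℓ‖ + ‖ctr ℓ‖ := norm_add_le _ _
    _ ≤ ℓ / 4 + ℓ / 2 := add_le_add hx hc.le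
    _ = 3 * ℓ / 4 := by ring

theorem wfun_tsupport_pos : tsupport (wfun ℓ hℓ : E4 → ℝ) ⊆ {y | 0 < y 0} := by
  intro x hx
  change x ∈ tsupport (bump ℓ hℓ) at hx
  rw [(bump ℓ hℓ).tsupport_eq, bump_rOut] at hx
  have := time_lower_of_mem hx
  show 0 < x 0
  linarith

theorem wfun_tsupport_ball : tsupport (wfun ℓ hℓ : E4 → ℝ) ⊆ closedBall 0 ℓ := by
  intro x hx
  change x ∈ tsupport (bump ℓ hℓ) at hx
  rw [(bump ℓ hℓ).tsupport_eq, bump_rOut] at hx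
  rw [mem_closedBall, dist_zero_right]
  have := norm_le_of_mem hℓ hx
  linarith

theorem wfun_nonneg (z : E4) : 0 ≤ wfun ℓ hℓ z := (bump ℓ hℓ).nonneg' z

theorem wfun_ne_zero : (wfun ℓ hℓ : E4 → ℝ) ≠ 0 := by
  intro h
  have h1 : wfun ℓ hℓ (ctr ℓ) = 1 := by
    rw [wfun_apply]
    exact (bump ℓ hℓ).one_of_mem_closedBall (mem_closedBall_self (by simp; positivity))
  have h2 : wfun ℓ hℓ (ctr ℓ) = 0 := by
    have := congr_fun h (ctr ℓ); simpa using this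
  rw [h1] at h2; exact one_ne_zero h2

/-- the probe equals `1` at every point whose coordinates are within `ℓ/16` of the centre's. -/
theorem wfun_eq_one_of_coord {x : E4} (h0 : |x 0 - ℓ / 2| ≤ ℓ / 16) (hk : ∀ k : Fin 4, k ≠ 0 → |x k| ≤ ℓ / 16) :
    wfun ℓ hℓ x = 1 := by
  rw [wfun_apply]
  apply (bump ℓ hℓ).one_of_mem_closedBall
  rw [mem_closedBall, dist_eq_norm, bump_rIn]
  have hsq : ‖x - ctr ℓ‖ ^ 2 ≤ (ℓ / 8) ^ 2 := by
    rw [EuclideanSpace.real_norm_sq_eq, Fin.sum_univ_four]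
    have e0 : (x - ctr ℓ) 0 = x 0 - ℓ / 2 := by simp [ctr_apply]
    have e1 : (x - ctr ℓ) 1 = x 1 := by simp [ctr_apply]
    have e2 : (x - ctr ℓ) 2 = x 2 := by simp [ctr_apply]
    have e3 : (x - ctr ℓ) 3 = x 3 := by simp [ctr_apply]
    rw [e0, e1, e2, e3]
    have s0 := sq_le_of_abs_le h0
    have s1 := sq_le_of_abs_le (hk 1 (by decide))
    have s2 := sq_le_of_abs_le (hk 2 (by decide))
    have s3 := sq_le_of_abs_le (hk 3 (by decide))
    nlinarith
  exact (pow_le_pow_iff_left₀ (norm_nonneg _) (by positivity) two_ne_zero).1 hsq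

end Scale


/-! ## the source: base point, plaquette coordinates, the sum over the rectangle -/

/-- base point `−X e₀` of the source rectangle -/
def xr (X : ℕ) : Site 4 := fun k => if k = 0 then -(X : ℤ) else 0

/-- the site of the `(m, n)` plaquette of the source -/
def px (X m n : ℕ) : Site 4 := xr X + (m : ℤ) • Pi.single 1 1 + (n : ℤ) • Pi.single 2 1

theorem px_apply_0 (X m n : ℕ) : px X m n 0 = -(X : ℤ) := by simp [px, xr]
theorem px_apply_1 (X m n : ℕ) : px X m n 1 = m := by simp [px, xr]
theorem px_apply_2 (X m n : ℕ) : px X m n 2 = n := by simp [px, xr]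
theorem px_apply_3 (X m n : ℕ) : px X m n 3 = 0 := by simp [px, xr]

theorem rectPlaq_eq (X R T : ℕ) : rectPlaq (xr X) P12 R T =
    (Finset.range R ×ˢ Finset.range T).image fun mn => (px X mn.1 mn.2, P12) := by
  simp [rectPlaq, px, P12]

theorem px_inj (X : ℕ) {mn mn' : ℕ × ℕ}
    (h : (px X mn.1 mn.2, P12) = (px X mn'.1 mn'.2, P12)) : mn = mn' := by
  have h1 := congr_arg (fun q : ZdPlaquette 4 => q.1 1) h
  have h2 := congr_arg (fun q : ZdPlaquette 4 => q.1 2) h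
  simp only [px_apply_1, px_apply_2, Nat.cast_inj] at h1 h2
  exact Prod.ext h1 h2

/-- the source's field at `q` as a sum over the `R × T` grid -/
theorem dipoleField_rect (X R T : ℕ) (q : ZdPlaquette 4) :
    dipoleField (rectPlaq (xr X) P12 R T) q =
      ∑ mn ∈ Finset.range R ×ˢ Finset.range T, curvatureTwoPoint (px X mn.1 mn.2, P12) q := by
  rw [dipoleField, rectPlaq_eq, Finset.sum_image]
  intro mn _ mn' _ h
  exact px_inj X h

/-! ## the probe box -/

/-- centre `X e₀` of the probe box -/
def cy (X : ℕ) : Site 4 := fun k => if k = 0 then (X : ℤ) else 0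

/-- the probe box `X e₀ + [−N, N]⁴` -/
def box (X N : ℕ) : Finset (Site 4) :=
  Fintype.piFinset fun k => Finset.Icc (cy X k - N) (cy X k + N)

theorem mem_box {X N : ℕ} {y : Site 4} : y ∈ box X N ↔ ∀ k, cy X k - N ≤ y k ∧ y k ≤ cy X k + N := by
  simp [box, Fintype.mem_piFinset, Finset.mem_Icc]

theorem card_box (X N : ℕ) : (box X N).card = (2 * N + 1) ^ 4 := by
  rw [box, Fintype.card_piFinset]
  simp only [Int.card_Icc]
  have : ∀ k : Fin 4, (cy X k + ↑N + 1 - (cy X k - ↑N)).toNat = 2 * N + 1 := by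
    intro k
    have : cy X k + ↑N + 1 - (cy X k - ↑N) = ((2 * N + 1 : ℕ) : ℤ) := by push_cast; ring
    rw [this, Int.toNat_natCast]
  simp only [this, Finset.prod_const, Finset.card_univ, Fintype.card_fin]


theorem cy_apply_0 (X : ℕ) : cy X 0 = (X : ℤ) := by simp [cy]
theorem cy_apply_ne (X : ℕ) {k : Fin 4} (hk : k ≠ 0) : cy X k = 0 := by simp [cy, hk]

/-- real-coordinate bounds of a probe-box site -/
theorem box_bounds {X N : ℕ} {y : Site 4} (hy : y ∈ box X N) :
    |((y 0 : ℤ) : ℝ) - X| ≤ N ∧ |((y 1 : ℤ) : ℝ)| ≤ N ∧ |((y 2 : ℤ) : ℝ)| ≤ N ∧ |((y 3 : ℤ) : ℝ)| ≤ N := by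
  rw [mem_box] at hy
  have h0 := hy 0; have h1 := hy 1; have h2 := hy 2; have h3 := hy 3
  rw [cy_apply_0] at h0
  rw [cy_apply_ne X (by decide)] at h1 h2 h3
  refine ⟨?_, ?_, ?_, ?_⟩ <;> rw [abs_le] <;> constructor
  · have : ((X : ℤ) : ℝ) - N ≤ ((y 0 : ℤ) : ℝ) := by exact_mod_cast h0.1
    push_cast at this; linarith
  · have : ((y 0 : ℤ) : ℝ) ≤ ((X : ℤ) : ℝ) + N := by exact_mod_cast h0.2
    push_cast at this; linarith
  · have : ((0 : ℤ) : ℝ) - N ≤ ((y 1 : ℤ) : ℝ) := by exact_mod_cast h1.1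
    push_cast at this; linarith
  · have : ((y 1 : ℤ) : ℝ) ≤ ((0 : ℤ) : ℝ) + N := by exact_mod_cast h1.2
    push_cast at this; linarith
  · have : ((0 : ℤ) : ℝ) - N ≤ ((y 2 : ℤ) : ℝ) := by exact_mod_cast h2.1
    push_cast at this; linarith
  · have : ((y 2 : ℤ) : ℝ) ≤ ((0 : ℤ) : ℝ) + N := by exact_mod_cast h2.2
    push_cast at this; linarith
  · have : ((0 : ℤ) : ℝ) - N ≤ ((y 3 : ℤ) : ℝ) := by exact_mod_cast h3.1
    push_cast at this; linarith
  · have : ((y 3 : ℤ) : ℝ) ≤ ((0 : ℤ) : ℝ) + N := by exact_mod_cast h3.2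
    push_cast at this; linarith

/-- `|z|²` of the separation between the `(m, n)` plaquette of the source and the probe site `y` -/
theorem S_px_sub (X m n : ℕ) (y : Site 4) :
    S (px X m n - y) = (-(X : ℝ) - ((y 0 : ℤ) : ℝ)) ^ 2 + ((m : ℝ) - ((y 1 : ℤ) : ℝ)) ^ 2 +
      ((n : ℝ) - ((y 2 : ℤ) : ℝ)) ^ 2 + (-((y 3 : ℤ) : ℝ)) ^ 2 := by
  rw [S_eq]
  simp only [Pi.sub_apply, px_apply_0, px_apply_1, px_apply_2, px_apply_3]
  push_cast
  ring

/-- the uniform kernel floor between every source plaquette and every probe site -/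
theorem kernel_lower_at {R₀ : ℝ}
    (hker : ∀ x y : Site 4,
      4 * ((((x - y) 1 : ℤ) : ℝ) ^ 2 + (((x - y) 2 : ℤ) : ℝ) ^ 2) ≤ S (x - y) → R₀ ^ 2 ≤ S (x - y) →
        1 / (4 * π ^ 2 * S (x - y) ^ 2) ≤ curvatureTwoPoint (x, P12) (y, P12))
    {X N m n : ℕ} {y : Site 4} (hR0 : 0 ≤ R₀) (hN : (1 : ℝ) ≤ N) (hR : R₀ ≤ N) (hX1 : 32 * (N : ℝ) ≤ X)
    (hX2 : (X : ℝ) ≤ 64 * N) (hm : m < N) (hn : n < N) (hy : y ∈ box X N) :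
    1 / (4 * π ^ 2 * (16650 * (N : ℝ) ^ 2) ^ 2) ≤ curvatureTwoPoint (px X m n, P12) (y, P12) := by
  obtain ⟨b0, b1, b2, b3⟩ := box_bounds hy
  have hm' : (m : ℝ) ≤ N := by exact_mod_cast hm.le
  have hn' : (n : ℝ) ≤ N := by exact_mod_cast hn.le
  obtain ⟨gcone, gfar, gnear⟩ := geom hN hX1 hX2 (Nat.cast_nonneg m) hm' (Nat.cast_nonneg n) hn' b0 b1 b2 b3
  have hS := S_px_sub X m n y
  have hz1 : (((px X m n - y) 1 : ℤ) : ℝ) = (m : ℝ) - ((y 1 : ℤ) : ℝ) := by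
    simp only [Pi.sub_apply, px_apply_1]; push_cast; ring
  have hz2 : (((px X m n - y) 2 : ℤ) : ℝ) = (n : ℝ) - ((y 2 : ℤ) : ℝ) := by
    simp only [Pi.sub_apply, px_apply_2]; push_cast; ring
  have h := hker (px X m n) y (by rw [hz1, hz2, hS]; exact gcone)
    (by rw [hS]; exact le_trans (by nlinarith [sq_nonneg (N - R₀)]) gfar)
  refine le_trans ?_ h
  have hSpos : 0 < S (px X m n - y) := by rw [hS]; nlinarith
  apply one_div_le_one_div_of_le (by positivity)
  have : S (px X m n - y) ≤ 16650 * (N : ℝ) ^ 2 := by rw [hS]; exact gnear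
  have h2 : S (px X m n - y) ^ 2 ≤ (16650 * (N : ℝ) ^ 2) ^ 2 := pow_le_pow_left₀ hSpos.le this 2
  nlinarith [Real.pi_pos, sq_nonneg π]


/-- the source's field at every probe site: `N²` plaquettes, each contributing `≥ k_min` -/
theorem dipoleField_lower {R₀ : ℝ}
    (hker : ∀ x y : Site 4,
      4 * ((((x - y) 1 : ℤ) : ℝ) ^ 2 + (((x - y) 2 : ℤ) : ℝ) ^ 2) ≤ S (x - y) → R₀ ^ 2 ≤ S (x - y) →
        1 / (4 * π ^ 2 * S (x - y) ^ 2) ≤ curvatureTwoPoint (x, P12) (y, P12))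
    {X N : ℕ} {y : Site 4} (hR0 : 0 ≤ R₀) (hN : (1 : ℝ) ≤ N) (hR : R₀ ≤ N) (hX1 : 32 * (N : ℝ) ≤ X)
    (hX2 : (X : ℝ) ≤ 64 * N) (hy : y ∈ box X N) :
    (N : ℝ) ^ 2 * (1 / (4 * π ^ 2 * (16650 * (N : ℝ) ^ 2) ^ 2)) ≤
      dipoleField (rectPlaq (xr X) P12 N N) (y, P12) := by
  rw [dipoleField_rect]
  have h := Finset.card_nsmul_le_sum (Finset.range N ×ˢ Finset.range N)
    (fun mn : ℕ × ℕ => curvatureTwoPoint (px X mn.1 mn.2, P12) (y, P12))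
    (1 / (4 * π ^ 2 * (16650 * (N : ℝ) ^ 2) ^ 2)) (by
      intro mn hmn
      rw [Finset.mem_product, Finset.mem_range, Finset.mem_range] at hmn
      exact kernel_lower_at hker hR0 hN hR hX1 hX2 hmn.1 hmn.2 hy)
  rw [Finset.card_product, Finset.card_range, nsmul_eq_mul] at h
  push_cast at h
  simpa [sq] using h

theorem box_subset_cube {X N L : ℕ} (h : X + N ≤ L) : box X N ⊆ cube L := by
  intro y hy
  rw [mem_box] at hy
  simp only [cube, Fintype.mem_piFinset, Finset.mem_Icc]
  intro k
  have hk := hy k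
  by_cases hk0 : k = 0
  · subst hk0; rw [cy_apply_0] at hk; omega
  · rw [cy_apply_ne X hk0] at hk; omega

theorem mem_plaqAt (y : Site 4) : (y, P12) ∈ plaqAt y :=
  Finset.mem_image.mpr ⟨P12, Finset.mem_univ _, rfl⟩

/-- the probe is `≡ 1` on the probe box once `aN ≤ ℓ/64` and `|aX − ℓ/2| ≤ ℓ/128` -/
theorem probe_one {ℓ : ℝ} (hℓ : 0 < ℓ) {a : ℝ} (ha : 0 ≤ a) {X N : ℕ} {y : Site 4} (hy : y ∈ box X N)
    (haX : |a * X - ℓ / 2| ≤ ℓ / 128) (haN : a * N ≤ ℓ / 64) : wfun ℓ hℓ (a • siteToE y) = 1 := by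
  obtain ⟨b0, b1, b2, b3⟩ := box_bounds hy
  apply wfun_eq_one_of_coord hℓ
  · simp only [PiLp.smul_apply, siteToE_apply, smul_eq_mul]
    have e : a * ((y 0 : ℤ) : ℝ) - ℓ / 2 = a * (((y 0 : ℤ) : ℝ) - X) + (a * X - ℓ / 2) := by ring
    rw [e]
    calc |a * (((y 0 : ℤ) : ℝ) - X) + (a * X - ℓ / 2)|
        ≤ |a * (((y 0 : ℤ) : ℝ) - X)| + |a * X - ℓ / 2| := abs_add_le _ _
      _ ≤ a * N + ℓ / 128 := by
          refine add_le_add ?_ haX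
          rw [abs_mul, abs_of_nonneg ha]
          exact mul_le_mul_of_nonneg_left b0 ha
      _ ≤ ℓ / 16 := by linarith
  · intro k hk
    simp only [PiLp.smul_apply, siteToE_apply, smul_eq_mul]
    rw [abs_mul, abs_of_nonneg ha]
    have hb : |((y k : ℤ) : ℝ)| ≤ N := by
      fin_cases k
      · exact absurd rfl hk
      · exact b1
      · exact b2
      · exact b3
    calc a * |((y k : ℤ) : ℝ)| ≤ a * N := mul_le_mul_of_nonneg_left hb ha
      _ ≤ ℓ / 16 := by linarith

/-- **The dipole-energy hyperscaling floor** (`= Rung.DipoleEnergyFloor`, the former plan-only stub). -/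
theorem dipoleEnergyFloor : DipoleEnergyFloor := by
  intro ℓ hℓ
  obtain ⟨R₀, hR₀1, hker⟩ := kernel_cone_lower
  have hR₀0 : 0 ≤ R₀ := by linarith
  refine ⟨wfun ℓ hℓ, 1 / (16 * π ^ 4 * 16650 ^ 4), ℓ / (128 * R₀), wfun_tsupport_pos hℓ,
    wfun_tsupport_ball hℓ, wfun_ne_zero hℓ, wfun_nonneg hℓ, by positivity, by positivity, ?_⟩
  intro a ha ha₀ L hL
  -- the two lattice scales `N = ⌊ℓ/(64a)⌋`, `X = ⌊ℓ/(2a)⌋`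
  set t : ℝ := ℓ / (64 * a) with ht
  have hat : a * t = ℓ / 64 := by rw [ht]; field_simp
  have ht2 : 2 * R₀ ≤ t := by
    rw [ht, le_div_iff₀ (by positivity)]
    have : a * (128 * R₀) ≤ ℓ := by rwa [le_div_iff₀ (by positivity)] at ha₀
    linarith
  set N : ℕ := ⌊t⌋₊ with hN
  have htN : (N : ℝ) ≤ t := Nat.floor_le (by positivity)
  have htN' : t < N + 1 := Nat.lt_floor_add_one t
  have hN1 : (1 : ℝ) ≤ N := by linarith
  have hRN : R₀ ≤ N := by linarith
  have hNnat : 1 ≤ N := by exact_mod_cast hN1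
  set X : ℕ := ⌊ℓ / (2 * a)⌋₊ with hX
  have hX32t : ℓ / (2 * a) = 32 * t := by rw [ht]; field_simp; ring
  have hXle : (X : ℝ) ≤ 32 * t := by rw [← hX32t]; exact Nat.floor_le (by positivity)
  have hXgt : 32 * t < X + 1 := by rw [← hX32t]; exact Nat.lt_floor_add_one _
  have hX1nat : 32 * N ≤ X := by
    have h : ((32 * N : ℕ) : ℝ) < X + 1 := by push_cast; linarith
    have h' : 32 * N < X + 1 := by exact_mod_cast h
    omega
  have hX1 : 32 * (N : ℝ) ≤ X := by exact_mod_cast hX1nat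
  have hX2 : (X : ℝ) ≤ 64 * N := by linarith
  have haN : a * N ≤ ℓ / 64 := by rw [← hat]; exact mul_le_mul_of_nonneg_left htN ha.le
  have haX : a * X ≤ ℓ / 2 := by
    have : a * X ≤ a * (32 * t) := mul_le_mul_of_nonneg_left hXle ha.le
    linarith [show a * (32 * t) = ℓ / 2 by rw [show a * (32 * t) = 32 * (a * t) by ring, hat]; ring]
  have haX' : ℓ / 2 - a < a * X := by
    have : a * (32 * t) < a * (X + 1) := mul_lt_mul_of_pos_left hXgt ha
    have e : a * (32 * t) = ℓ / 2 := by rw [show a * (32 * t) = 32 * (a * t) by ring, hat]; ring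
    linarith
  have ha128 : a ≤ ℓ / 128 := by
    have : a * (128 * R₀) ≤ ℓ := by rwa [le_div_iff₀ (by positivity)] at ha₀
    rw [le_div_iff₀ (by norm_num)]
    nlinarith
  have habsX : |a * X - ℓ / 2| ≤ ℓ / 128 := by
    rw [abs_le]; constructor <;> linarith
  have hxr0 : xr X 0 = -(X : ℤ) := by simp [xr]
  have hxr0R : ((xr X 0 : ℤ) : ℝ) = -(X : ℝ) := by rw [hxr0]; push_cast; ring
  refine ⟨xr X, P12, N, N, hNnat, hNnat, ?_, ?_, ?_, ?_⟩
  · rw [hxr0]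
    have h1 : (32 * N : ℤ) ≤ X := by exact_mod_cast hX1nat
    have h2 : (1 : ℤ) ≤ N := by exact_mod_cast hNnat
    linarith
  · rw [hxr0R]
    linarith
  · intro k
    by_cases hk : k = 0
    · subst hk
      rw [hxr0R, abs_neg, Nat.abs_cast]
      linarith
    · have : xr X k = 0 := by simp [xr, hk]
      rw [this]
      push_cast
      rw [abs_zero, zero_mul]
      exact hℓ.le
  · -- the floor
    have hsub : box X N ⊆ cube L := by
      apply box_subset_cube
      have h1 : ((X : ℝ) + N) ≤ L := by
        have hLa : ℓ / a ≤ L := by rw [div_le_iff₀ ha]; linarith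
        have : (X : ℝ) + N ≤ 33 * t := by linarith
        have e : ℓ / a = 64 * t := by rw [ht]; field_simp
        have : 33 * t ≤ 64 * t := by nlinarith
        linarith
      exact_mod_cast h1
    set kmin : ℝ := 1 / (4 * π ^ 2 * (16650 * (N : ℝ) ^ 2) ^ 2) with hkmin
    have hkmin0 : 0 ≤ (N : ℝ) ^ 2 * kmin := by positivity
    have hterm : ∀ y ∈ box X N, ((N : ℝ) ^ 2 * kmin) ^ 2 ≤
        wfun ℓ hℓ (a • siteToE y) * ∑ q ∈ plaqAt y, dipoleField (rectPlaq (xr X) P12 N N) q ^ 2 := by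
      intro y hy
      rw [probe_one hℓ ha.le hy habsX haN, one_mul]
      refine le_trans ?_ (Finset.single_le_sum (fun q _ => sq_nonneg _) (mem_plaqAt y))
      exact pow_le_pow_left₀ hkmin0 (dipoleField_lower hker hR₀0 hN1 hRN hX1 hX2 hy) 2
    have hN0 : (0 : ℝ) < N := by linarith
    calc 1 / (16 * π ^ 4 * 16650 ^ 4) = (N : ℝ) ^ 4 * ((N : ℝ) ^ 2 * kmin) ^ 2 := by
          rw [hkmin]; field_simp; ring
      _ ≤ ((box X N).card : ℝ) * ((N : ℝ) ^ 2 * kmin) ^ 2 := by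
          rw [card_box]; push_cast
          apply mul_le_mul_of_nonneg_right _ (sq_nonneg _)
          have : (N : ℝ) ≤ 2 * N + 1 := by linarith
          exact pow_le_pow_left₀ hN0.le this 4
      _ = (box X N).card • ((N : ℝ) ^ 2 * kmin) ^ 2 := by rw [nsmul_eq_mul]
      _ ≤ ∑ y ∈ box X N, wfun ℓ hℓ (a • siteToE y) *
            ∑ q ∈ plaqAt y, dipoleField (rectPlaq (xr X) P12 N N) q ^ 2 :=
          Finset.card_nsmul_le_sum _ _ _ hterm
      _ ≤ dipoleEnergy a (wfun ℓ hℓ) (rectPlaq (xr X) P12 N N) L := by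
          apply Finset.sum_le_sum_of_subset_of_nonneg hsub
          intro y _ _
          exact mul_nonneg (wfun_nonneg hℓ _) (Finset.sum_nonneg fun _ _ => sq_nonneg _)


/-- **The lattice-Maxwell rung of X₁, UNCONDITIONAL** (v3): the X₁-shaped static-source response
statement — a probe per window `ℓ`, `c₁, a₀ > 0` uniform in the spacing `a ≤ a₀` and the volume `L`,
a mirror rectangle strictly inside `{y₀ < 0}` within distance `ℓ`, and the witness clause
`0 < E[w] ∧ c₁·E[w] ≤ |Cov(w, Ṽ_v)|` — in the abelian lattice gauge theory `curvatureGaussianField 4 1`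
at fixed coupling.  (BC5/T3 witness for `StaticSourceResponse`; the separation from S is
`freeAbelian_NT_clauseII_false` above.) [this route] -/
theorem latticeMaxwell_staticSourceResponse :
    ∀ ℓ : ℝ, 0 < ℓ → ∃ (v : SchwartzMap E4 ℝ) (c₁ a₀ : ℝ),
      tsupport (v : E4 → ℝ) ⊆ {y | 0 < y 0} ∧ tsupport (v : E4 → ℝ) ⊆ Metric.closedBall 0 ℓ ∧
      (v : E4 → ℝ) ≠ 0 ∧ 0 < c₁ ∧ 0 < a₀ ∧
      ∀ a : ℝ, 0 < a → a ≤ a₀ → ∀ L : ℕ, ℓ ≤ a * L →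
        ∃ (x : Site 4) (ij : Plane) (R T : ℕ), 1 ≤ R ∧ 1 ≤ T ∧
          ((x 0 : ℤ) + R + T ≤ -1) ∧ (-ℓ ≤ a * (x 0 : ℝ)) ∧ (∀ k, |(x k : ℝ)| * a ≤ ℓ) ∧
          0 < ∫ ω, wLoop (rectPlaq x ij R T) ω ∂μM ∧
          c₁ * ∫ ω, wLoop (rectPlaq x ij R T) ω ∂μM ≤
            |(∫ ω, wLoop (rectPlaq x ij R T) ω * probe a (v : E4 → ℝ) L ω ∂μM)
              - (∫ ω, wLoop (rectPlaq x ij R T) ω ∂μM) * (∫ ω, probe a (v : E4 → ℝ) L ω ∂μM)| :=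
  latticeMaxwell_staticSourceResponse_of_floor dipoleEnergyFloor

end Floor

end Summit.QuantumFields.YangMills.Cruxes.StaticSourceResponse.Rung

end

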